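import Mathlib

/-!
# The tensor (binor) model of the Temperley–Lieb category: definitions

Kauffman–Lins' Temperley–Lieb recoupling theory [KL94] is formalized in the concrete **binor (spin-network
tensor) model** of KL94 §8.2: a morphism `m → n` is a matrix `(ℕ → Bool) → (ℕ → Bool) → K` reading only the
first `m` input / `n` output bits (`Mor K m n`), the tensor product is juxtaposition of bit-strings (strict
on the nose), the cup and cap are the `ε`-spinors `ε_{+-} = A`, `ε_{-+} = -A⁻¹` (loop value
`d = -A² - A⁻²`). This file holds ALL the definitions of the development (so that the theorem files are
definition-free): raw operations, typed morphisms `Mor`, cup/cap, the hook `U`, Chebyshev numbers `Δ_n`,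
partial and full traces, the Jones–Wenzl projectors `f_n` (Wenzl recursion), positional cups/caps, the
Temperley–Lieb subcategory `IsTL`, negligible morphisms `Neg`, 3-vertices `vert/V`, θ-nets, trees, the
tetrahedral trace `Tnet` and the recoupling coefficients `Fco = Tet·Δ/(θθ)` (KL94 Prop. 11 as a DEFINITION),
quantum integers/factorials, and the closed forms (`SZ` Racah sum, `sixjP`, `sixjR`) of the q-6j symbol,
plus `klA k = e^{iπ/(2(k+2))}`. Everything is over an arbitrary field `K` with a parameter `A : K`.

What is proved about them lives in the sibling files `Basic`, `Category`, `Vertex`, `Theta`, `Recoupling`,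
`Elementary`, `SixJ`, … (sorry-free). Design choices: strictly associative ⊗ via bit-string shifts; labels
and strand positions are data (`cupAt A n i`), casts `Mor.cast` along propositional equalities of sizes.

## References
* [KL94] L. H. Kauffman, S. Lins, *Temperley–Lieb Recoupling Theory and Invariants of 3-Manifolds*,
  Ann. of Math. Studies 134 (1994), §§2–4, 6–9. [KauffmanLins1994]
* G. Masbaum, P. Vogel, *3-valent graphs and the Kauffman bracket*, Pacific J. Math. 164 (1994). [MasbaumVogel1994]
-/

noncomputable section

open BigOperators Finset

namespace Literature.RepresentationTheory.ModularTensorCategories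

namespace TemperleyLieb

/-- Bit-strings indexing the tensor basis `e_{s 0} ⊗ e_{s 1} ⊗ ⋯` (`true = e₊`); only an
initial segment is ever relevant. [folklore] -/
abbrev Idx := ℕ → Bool

/-- Raw morphisms of the tensor model: matrices indexed by bit-strings (rows = output strands,
columns = input strands), the relevant numbers of strands being supplied by each operation.
[cite: KauffmanLins1994, §8.2] -/
abbrev Raw (K : Type*) [Field K] := Idx → Idx → K

variable {K : Type*} [Field K]
variable {m n p m' n' p' m'' n'' : ℕ}

/-! ### Bit-string bookkeeping -/

/-- Two bit-strings agree on their first `n` bits. [folklore] -/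
def Agree (n : ℕ) (s t : Idx) : Prop := ∀ i < n, s i = t i

/-- Decidability instance (by unfolding the definition). [folklore] -/
instance (n : ℕ) (s t : Idx) : Decidable (Agree n s t) := by unfold Agree; infer_instance

/-- Bookkeeping lemma `refl` of the binor tensor model of Temperley–Lieb recoupling theory (conventions of KL94 §8.2, §9). [folklore] -/
theorem Agree.refl (n : ℕ) (s : Idx) : Agree n s s := fun _ _ => rfl

/-- Bookkeeping lemma `symm` of the binor tensor model of Temperley–Lieb recoupling theory (conventions of KL94 §8.2, §9). [folklore] -/
theorem Agree.symm {n : ℕ} {s t : Idx} (h : Agree n s t) : Agree n t s := fun i hi => (h i hi).symm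

/-- Bookkeeping lemma `trans` of the binor tensor model of Temperley–Lieb recoupling theory (conventions of KL94 §8.2, §9). [folklore] -/
theorem Agree.trans {n : ℕ} {s t u : Idx} (h : Agree n s t) (h' : Agree n t u) : Agree n s u :=
  fun i hi => (h i hi).trans (h' i hi)

/-- Bookkeeping lemma `mono` of the binor tensor model of Temperley–Lieb recoupling theory (conventions of KL94 §8.2, §9). [folklore] -/
theorem Agree.mono {n n' : ℕ} (hn : n' ≤ n) {s t : Idx} (h : Agree n s t) : Agree n' s t :=
  fun i hi => h i (lt_of_lt_of_le hi hn)

/-- Padding of a finite bit-string by `false`. [folklore] -/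
def pad (u : Fin n → Bool) : Idx := fun i => if h : i < n then u ⟨i, h⟩ else false

/-- The first `n` bits. [folklore] -/
def take (n : ℕ) (s : Idx) : Fin n → Bool := fun i => s i

/-- Dropping the first `n` bits. [folklore] -/
def shift (n : ℕ) (s : Idx) : Idx := fun i => s (n + i)

/-- Bookkeeping lemma `pad_apply_lt` of the binor tensor model of Temperley–Lieb recoupling theory (conventions of KL94 §8.2, §9). [folklore] -/
@[simp] theorem pad_apply_lt (u : Fin n → Bool) {i : ℕ} (h : i < n) : pad u i = u ⟨i, h⟩ := dif_pos h

/-- Bookkeeping lemma `pad_apply_ge` of the binor tensor model of Temperley–Lieb recoupling theory (conventions of KL94 §8.2, §9). [folklore] -/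
@[simp] theorem pad_apply_ge (u : Fin n → Bool) {i : ℕ} (h : n ≤ i) : pad u i = false :=
  dif_neg (not_lt.mpr h)

/-- Bookkeeping lemma `take_pad` of the binor tensor model of Temperley–Lieb recoupling theory (conventions of KL94 §8.2, §9). [folklore] -/
@[simp] theorem take_pad (u : Fin n → Bool) : take n (pad u) = u := by
  funext i; simp [take, pad]

/-- Bookkeeping lemma `agree_pad_take` of the binor tensor model of Temperley–Lieb recoupling theory (conventions of KL94 §8.2, §9). [folklore] -/
theorem agree_pad_take (n : ℕ) (s : Idx) : Agree n (pad (take n s)) s := by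
  intro i hi; simp [take, hi]

/-- Bookkeeping lemma `agree_pad_iff` of the binor tensor model of Temperley–Lieb recoupling theory (conventions of KL94 §8.2, §9). [folklore] -/
theorem agree_pad_iff (s : Idx) (u : Fin n → Bool) : Agree n s (pad u) ↔ take n s = u := by
  constructor
  · intro h; funext i; simpa [take] using h i i.2
  · rintro rfl; exact (agree_pad_take n s).symm

/-- Bookkeeping lemma `shift_zero` of the binor tensor model of Temperley–Lieb recoupling theory (conventions of KL94 §8.2, §9). [folklore] -/
@[simp] theorem shift_zero (s : Idx) : shift 0 s = s := by funext i; simp [shift]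

/-- Bookkeeping lemma `shift_shift` of the binor tensor model of Temperley–Lieb recoupling theory (conventions of KL94 §8.2, §9). [folklore] -/
theorem shift_shift (a b : ℕ) (s : Idx) : shift b (shift a s) = shift (a + b) s := by
  funext i; simp [shift, Nat.add_assoc]

/-- Bookkeeping lemma `shift_apply` of the binor tensor model of Temperley–Lieb recoupling theory (conventions of KL94 §8.2, §9). [folklore] -/
@[simp] theorem shift_apply (a : ℕ) (s : Idx) (i : ℕ) : shift a s i = s (a + i) := rfl

/-- Bookkeeping lemma `shift_pad_append` of the binor tensor model of Temperley–Lieb recoupling theory (conventions of KL94 §8.2, §9). [folklore] -/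
theorem shift_pad_append (u : Fin n → Bool) (v : Fin n' → Bool) :
    shift n (pad (Fin.append u v)) = pad v := by
  funext i
  by_cases h : i < n'
  · rw [shift_apply, pad_apply_lt _ (by omega), pad_apply_lt _ h]
    have : (⟨n + i, by omega⟩ : Fin (n + n')) = Fin.natAdd n ⟨i, h⟩ := rfl
    rw [this, Fin.append_right]
  · rw [shift_apply, pad_apply_ge _ (by omega), pad_apply_ge _ (by omega)]

/-- Bookkeeping lemma `agree_pad_append` of the binor tensor model of Temperley–Lieb recoupling theory (conventions of KL94 §8.2, §9). [folklore] -/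
theorem agree_pad_append (u : Fin n → Bool) (v : Fin n' → Bool) :
    Agree n (pad (Fin.append u v)) (pad u) := by
  intro i hi
  rw [pad_apply_lt _ (by omega), pad_apply_lt _ hi]
  exact Fin.append_left u v ⟨i, hi⟩

/-- Bookkeeping lemma `agree_add_iff` of the binor tensor model of Temperley–Lieb recoupling theory (conventions of KL94 §8.2, §9). [folklore] -/
theorem agree_add_iff (s t : Idx) : Agree (n + n') s t ↔ Agree n s t ∧ Agree n' (shift n s) (shift n t) := by
  constructor
  · intro h
    exact ⟨fun i hi => h i (by omega), fun i hi => h (n + i) (by omega)⟩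
  · rintro ⟨h1, h2⟩ i hi
    by_cases h' : i < n
    · exact h1 i h'
    · have := h2 (i - n) (by omega)
      simp only [shift_apply] at this
      rwa [show n + (i - n) = i by omega] at this

/-- Bit-strings of length `n + n'` are pairs. [folklore] -/
def splitEquiv (n n' : ℕ) : (Fin (n + n') → Bool) ≃ (Fin n → Bool) × (Fin n' → Bool) where
  toFun s := (fun i => s (Fin.castAdd n' i), fun i => s (Fin.natAdd n i))
  invFun p := Fin.append p.1 p.2
  left_inv s := by
    funext i
    refine Fin.addCases (fun j => ?_) (fun j => ?_) i <;> simp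
  right_inv p := by
    ext i <;> simp

/-- Bookkeeping lemma `sum_split` of the binor tensor model of Temperley–Lieb recoupling theory (conventions of KL94 §8.2, §9). [folklore] -/
theorem sum_split {M : Type*} [AddCommMonoid M] (F : (Fin (n + n') → Bool) → M) :
    ∑ s, F s = ∑ u : Fin n → Bool, ∑ v : Fin n' → Bool, F (Fin.append u v) := by
  rw [← Fintype.sum_prod_type', ← (splitEquiv n n').symm.sum_comp]
  rfl

/-- The Kronecker sum `∑_u [s agrees with u] F u = F (take s)`. [folklore] -/
theorem sum_ite_agree_pad {M : Type*} [AddCommMonoid M] (s : Idx) (F : (Fin n → Bool) → M) :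
    ∑ u : Fin n → Bool, (if Agree n s (pad u) then F u else 0) = F (take n s) := by
  rw [Finset.sum_eq_single (take n s)]
  · simp [agree_pad_iff]
  · intro u _ hu
    rw [if_neg]
    rwa [agree_pad_iff, eq_comm]
  · simp

/-! ### Raw operations -/

/-- Identity on `n` strands. [folklore] -/
def idR (n : ℕ) : Raw K := fun s t => if Agree n s t then 1 else 0

/-- Composition `X ∘ Y` through `n` middle strands. [folklore] -/
def compR (n : ℕ) (X Y : Raw K) : Raw K := fun s t => ∑ u : Fin n → Bool, X s (pad u) * Y (pad u) t

/-- Tensor product: `X` (with `n` outputs, `m` inputs) on the first strands, `Y` on the rest.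
[cite: KauffmanLins1994, §8.2] -/
def tensR (n m : ℕ) (X Y : Raw K) : Raw K := fun s t => X s t * Y (shift n s) (shift m t)

/-- Row-respect: `X` reads only the first `n` output bits. [folklore] -/
def RespR (n : ℕ) (X : Raw K) : Prop := ∀ ⦃s s' : Idx⦄ (t : Idx), Agree n s s' → X s t = X s' t

/-- Column-respect: `X` reads only the first `m` input bits. [folklore] -/
def RespC (m : ℕ) (X : Raw K) : Prop := ∀ (s : Idx) ⦃t t' : Idx⦄, Agree m t t' → X s t = X s t'

/-- Bookkeeping lemma `idR_apply` of the binor tensor model of Temperley–Lieb recoupling theory (conventions of KL94 §8.2, §9). [folklore] -/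
theorem idR_apply (n : ℕ) (s t : Idx) : idR (K := K) n s t = if Agree n s t then 1 else 0 := rfl

/-- Bookkeeping lemma `idR_zero` of the binor tensor model of Temperley–Lieb recoupling theory (conventions of KL94 §8.2, §9). [folklore] -/
@[simp] theorem idR_zero : idR (K := K) 0 = fun _ _ => 1 := by
  funext s t; simp [idR, Agree]

/-- Bookkeeping lemma `compR_apply` of the binor tensor model of Temperley–Lieb recoupling theory (conventions of KL94 §8.2, §9). [folklore] -/
theorem compR_apply (n : ℕ) (X Y : Raw K) (s t : Idx) :
    compR n X Y s t = ∑ u : Fin n → Bool, X s (pad u) * Y (pad u) t := rfl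

/-- Bookkeeping lemma `tensR_apply` of the binor tensor model of Temperley–Lieb recoupling theory (conventions of KL94 §8.2, §9). [folklore] -/
theorem tensR_apply (n m : ℕ) (X Y : Raw K) (s t : Idx) :
    tensR n m X Y s t = X s t * Y (shift n s) (shift m t) := rfl

/-! #### Respect lemmas -/

/-- Bookkeeping lemma `idR` of the binor tensor model of Temperley–Lieb recoupling theory (conventions of KL94 §8.2, §9). [folklore] -/
theorem RespR.idR (n : ℕ) : RespR n (idR (K := K) n) := by
  intro s s' t h
  simp only [idR_apply]
  by_cases h1 : Agree n s t
  · rw [if_pos h1, if_pos (h.symm.trans h1)]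
  · rw [if_neg h1, if_neg (fun h2 => h1 (h.trans h2))]

/-- Bookkeeping lemma `idR` of the binor tensor model of Temperley–Lieb recoupling theory (conventions of KL94 §8.2, §9). [folklore] -/
theorem RespC.idR (n : ℕ) : RespC n (idR (K := K) n) := by
  intro s t t' h
  simp only [idR_apply]
  by_cases h1 : Agree n s t
  · rw [if_pos h1, if_pos (h1.trans h)]
  · rw [if_neg h1, if_neg (fun h2 => h1 (h2.trans h.symm))]

/-- Bookkeeping lemma `compR` of the binor tensor model of Temperley–Lieb recoupling theory (conventions of KL94 §8.2, §9). [folklore] -/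
theorem RespR.compR (n : ℕ) {X : Raw K} (hX : RespR p X) (Y : Raw K) : RespR p (compR n X Y) := by
  intro s s' t h
  simp only [compR_apply]
  exact Finset.sum_congr rfl (fun u _ => by rw [hX _ h])

/-- Bookkeeping lemma `compR` of the binor tensor model of Temperley–Lieb recoupling theory (conventions of KL94 §8.2, §9). [folklore] -/
theorem RespC.compR (n : ℕ) (X : Raw K) {Y : Raw K} (hY : RespC m Y) : RespC m (compR n X Y) := by
  intro s t t' h
  simp only [compR_apply]
  exact Finset.sum_congr rfl (fun u _ => by rw [hY _ h])

/-- Bookkeeping lemma `tensR` of the binor tensor model of Temperley–Lieb recoupling theory (conventions of KL94 §8.2, §9). [folklore] -/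
theorem RespR.tensR {X Y : Raw K} (hX : RespR n X) (hY : RespR n' Y) (m : ℕ) :
    RespR (n + n') (tensR n m X Y) := by
  intro s s' t h
  rw [agree_add_iff] at h
  simp only [tensR_apply, hX t h.1, hY _ h.2]

/-- Bookkeeping lemma `tensR` of the binor tensor model of Temperley–Lieb recoupling theory (conventions of KL94 §8.2, §9). [folklore] -/
theorem RespC.tensR {X Y : Raw K} (hX : RespC m X) (hY : RespC m' Y) (n : ℕ) :
    RespC (m + m') (tensR n m X Y) := by
  intro s t t' h
  rw [agree_add_iff] at h
  simp only [tensR_apply, hX s h.1, hY _ h.2]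

/-- Bookkeeping lemma `add` of the binor tensor model of Temperley–Lieb recoupling theory (conventions of KL94 §8.2, §9). [folklore] -/
theorem RespR.add {X Y : Raw K} (hX : RespR n X) (hY : RespR n Y) : RespR n (X + Y) :=
  fun s s' t h => by simp only [Pi.add_apply, hX t h, hY t h]

/-- Bookkeeping lemma `add` of the binor tensor model of Temperley–Lieb recoupling theory (conventions of KL94 §8.2, §9). [folklore] -/
theorem RespC.add {X Y : Raw K} (hX : RespC m X) (hY : RespC m Y) : RespC m (X + Y) :=
  fun s t t' h => by simp only [Pi.add_apply, hX s h, hY s h]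

/-- Bookkeeping lemma `smul` of the binor tensor model of Temperley–Lieb recoupling theory (conventions of KL94 §8.2, §9). [folklore] -/
theorem RespR.smul {α : Type*} [SMul α K] (c : α) {X : Raw K} (hX : RespR n X) : RespR n (c • X) :=
  fun s s' t h => by simp only [Pi.smul_apply, hX t h]

/-- Bookkeeping lemma `smul` of the binor tensor model of Temperley–Lieb recoupling theory (conventions of KL94 §8.2, §9). [folklore] -/
theorem RespC.smul {α : Type*} [SMul α K] (c : α) {X : Raw K} (hX : RespC m X) : RespC m (c • X) :=
  fun s t t' h => by simp only [Pi.smul_apply, hX s h]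

/-- Bookkeeping lemma `zero` of the binor tensor model of Temperley–Lieb recoupling theory (conventions of KL94 §8.2, §9). [folklore] -/
theorem RespR.zero (n : ℕ) : RespR n (0 : Raw K) := fun _ _ _ _ => rfl

/-- Bookkeeping lemma `zero` of the binor tensor model of Temperley–Lieb recoupling theory (conventions of KL94 §8.2, §9). [folklore] -/
theorem RespC.zero (m : ℕ) : RespC m (0 : Raw K) := fun _ _ _ _ => rfl

/-- Bookkeeping lemma `neg` of the binor tensor model of Temperley–Lieb recoupling theory (conventions of KL94 §8.2, §9). [folklore] -/
theorem RespR.neg {X : Raw K} (hX : RespR n X) : RespR n (-X) :=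
  fun s s' t h => by simp only [Pi.neg_apply, hX t h]

/-- Bookkeeping lemma `neg` of the binor tensor model of Temperley–Lieb recoupling theory (conventions of KL94 §8.2, §9). [folklore] -/
theorem RespC.neg {X : Raw K} (hX : RespC m X) : RespC m (-X) :=
  fun s t t' h => by simp only [Pi.neg_apply, hX s h]

/-- Bookkeeping lemma `sub` of the binor tensor model of Temperley–Lieb recoupling theory (conventions of KL94 §8.2, §9). [folklore] -/
theorem RespR.sub {X Y : Raw K} (hX : RespR n X) (hY : RespR n Y) : RespR n (X - Y) :=
  fun s s' t h => by simp only [Pi.sub_apply, hX t h, hY t h]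

/-- Bookkeeping lemma `sub` of the binor tensor model of Temperley–Lieb recoupling theory (conventions of KL94 §8.2, §9). [folklore] -/
theorem RespC.sub {X Y : Raw K} (hX : RespC m X) (hY : RespC m Y) : RespC m (X - Y) :=
  fun s t t' h => by simp only [Pi.sub_apply, hX s h, hY s h]

/-! #### Laws -/

/-- Bookkeeping lemma `compR_assoc` of the binor tensor model of Temperley–Lieb recoupling theory (conventions of KL94 §8.2, §9). [folklore] -/
theorem compR_assoc (X Y Z : Raw K) : compR n X (compR m Y Z) = compR m (compR n X Y) Z := by
  funext s t
  simp only [compR_apply, Finset.mul_sum, Finset.sum_mul, mul_assoc]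
  rw [Finset.sum_comm]

/-- Bookkeeping lemma `idR_compR` of the binor tensor model of Temperley–Lieb recoupling theory (conventions of KL94 §8.2, §9). [folklore] -/
theorem idR_compR {Y : Raw K} (hY : RespR n Y) : compR n (idR n) Y = Y := by
  funext s t
  simp only [compR_apply, idR_apply, ite_mul, one_mul, zero_mul]
  rw [sum_ite_agree_pad]
  exact hY t (agree_pad_take n s)

/-- Bookkeeping lemma `compR_idR` of the binor tensor model of Temperley–Lieb recoupling theory (conventions of KL94 §8.2, §9). [folklore] -/
theorem compR_idR {X : Raw K} (hX : RespC n X) : compR n X (idR n) = X := by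
  funext s t
  simp only [compR_apply, idR_apply, mul_ite, mul_one, mul_zero]
  have : ∀ u : Fin n → Bool, (if Agree n (pad u) t then X s (pad u) else 0) =
      if Agree n t (pad u) then X s (pad u) else 0 := fun u => by
    by_cases h : Agree n (pad u) t
    · rw [if_pos h, if_pos h.symm]
    · rw [if_neg h, if_neg (fun h' => h h'.symm)]
  simp only [this]
  rw [sum_ite_agree_pad]
  exact hX s (agree_pad_take n t)

/-- Interchange law `(X ⊗ Y)(X' ⊗ Y') = XX' ⊗ YY'`. [folklore] -/
theorem compR_tensR_tensR {X Y X' Y' : Raw K} (hX : RespC n X) (hX' : RespR n X') :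
    compR (n + n') (tensR p n X Y) (tensR n m X' Y') = tensR p m (compR n X X') (compR n' Y Y') := by
  funext s t
  simp only [compR_apply, tensR_apply, sum_split, shift_pad_append, Finset.sum_mul_sum]
  refine Finset.sum_congr rfl (fun u _ => Finset.sum_congr rfl (fun v _ => ?_))
  rw [hX s (agree_pad_append u v), hX' t (agree_pad_append u v)]
  ring

/-- Interchange law, the case of no middle strands on the right. [folklore] -/
theorem compR_tensR_tensR_zero {X Y X' Y' : Raw K} (hX : RespC n X) (hX' : RespR n X') :
    compR n (tensR p n X Y) (tensR n m X' Y') = tensR p m (compR n X X') (compR 0 Y Y') := by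
  simpa using compR_tensR_tensR (n' := 0) (Y := Y) (Y' := Y') hX hX'

/-- `𝟙_k ⊗ (P ∘ Q) = (𝟙_k ⊗ P) ∘ (𝟙_k ⊗ Q)`. [folklore] -/
theorem idR_tensR_compR (k j : ℕ) (P Q : Raw K) :
    tensR k k (idR k) (compR j P Q) = compR (k + j) (tensR k k (idR k) P) (tensR k k (idR k) Q) := by
  rw [compR_tensR_tensR (RespC.idR k) (RespR.idR k), idR_compR (RespR.idR k)]

/-- `(P ∘ Q) ⊗ 𝟙_k = (P ⊗ 𝟙_k) ∘ (Q ⊗ 𝟙_k)`. [folklore] -/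
theorem tensR_compR_idR {a b j : ℕ} (k : ℕ) {P Q : Raw K} (hP : RespC j P) (hQ : RespR j Q) :
    tensR a b (compR j P Q) (idR k) = compR (j + k) (tensR a j P (idR k)) (tensR j b Q (idR k)) := by
  rw [compR_tensR_tensR hP hQ, idR_compR (RespR.idR k)]

/-- Bookkeeping lemma `tensR_assoc` of the binor tensor model of Temperley–Lieb recoupling theory (conventions of KL94 §8.2, §9). [folklore] -/
theorem tensR_assoc (X Y Z : Raw K) :
    tensR n m X (tensR n' m' Y Z) = tensR (n + n') (m + m') (tensR n m X Y) Z := by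
  funext s t
  simp only [tensR_apply, shift_shift, mul_assoc]

/-- Bookkeeping lemma `tensR_idR_idR` of the binor tensor model of Temperley–Lieb recoupling theory (conventions of KL94 §8.2, §9). [folklore] -/
theorem tensR_idR_idR (n n' : ℕ) : tensR n n (idR n) (idR n') = idR (K := K) (n + n') := by
  funext s t
  simp only [tensR_apply, idR_apply, agree_add_iff (n := n) (n' := n') s t]
  by_cases h1 : Agree n s t <;> by_cases h2 : Agree n' (shift n s) (shift n t) <;> simp [h1, h2]

/-- Bookkeeping lemma `tensR_idR_zero` of the binor tensor model of Temperley–Lieb recoupling theory (conventions of KL94 §8.2, §9). [folklore] -/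
@[simp] theorem tensR_idR_zero (X : Raw K) : tensR n m X (idR 0) = X := by
  funext s t; simp [tensR_apply]

/-- Bookkeeping lemma `tensR_zero_zero_idR_zero` of the binor tensor model of Temperley–Lieb recoupling theory (conventions of KL94 §8.2, §9). [folklore] -/
@[simp] theorem tensR_zero_zero_idR_zero (X : Raw K) : tensR 0 0 (idR 0) X = X := by
  funext s t; simp [tensR_apply]

/-- Bookkeeping lemma `tensR_add` of the binor tensor model of Temperley–Lieb recoupling theory (conventions of KL94 §8.2, §9). [folklore] -/
theorem tensR_add (X Y Y' : Raw K) : tensR n m X (Y + Y') = tensR n m X Y + tensR n m X Y' := by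
  funext s t; simp [tensR_apply, mul_add]

/-- Bookkeeping lemma `add_tensR` of the binor tensor model of Temperley–Lieb recoupling theory (conventions of KL94 §8.2, §9). [folklore] -/
theorem add_tensR (X X' Y : Raw K) : tensR n m (X + X') Y = tensR n m X Y + tensR n m X' Y := by
  funext s t; simp [tensR_apply, add_mul]

/-- Bookkeeping lemma `tensR_sub` of the binor tensor model of Temperley–Lieb recoupling theory (conventions of KL94 §8.2, §9). [folklore] -/
theorem tensR_sub (X Y Y' : Raw K) : tensR n m X (Y - Y') = tensR n m X Y - tensR n m X Y' := by
  funext s t; simp [tensR_apply, mul_sub]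

/-- Bookkeeping lemma `sub_tensR` of the binor tensor model of Temperley–Lieb recoupling theory (conventions of KL94 §8.2, §9). [folklore] -/
theorem sub_tensR (X X' Y : Raw K) : tensR n m (X - X') Y = tensR n m X Y - tensR n m X' Y := by
  funext s t; simp [tensR_apply, sub_mul]

/-- Bookkeeping lemma `tensR_smul` of the binor tensor model of Temperley–Lieb recoupling theory (conventions of KL94 §8.2, §9). [folklore] -/
theorem tensR_smul (X : Raw K) (c : K) (Y : Raw K) : tensR n m X (c • Y) = c • tensR n m X Y := by
  funext s t; simp [tensR_apply]; ring

/-- Bookkeeping lemma `smul_tensR` of the binor tensor model of Temperley–Lieb recoupling theory (conventions of KL94 §8.2, §9). [folklore] -/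
theorem smul_tensR (c : K) (X Y : Raw K) : tensR n m (c • X) Y = c • tensR n m X Y := by
  funext s t; simp [tensR_apply]; ring

/-- Bookkeeping lemma `tensR_zero` of the binor tensor model of Temperley–Lieb recoupling theory (conventions of KL94 §8.2, §9). [folklore] -/
@[simp] theorem tensR_zero (X : Raw K) : tensR n m X 0 = 0 := by
  funext s t; simp [tensR_apply]

/-- Bookkeeping lemma `zero_tensR` of the binor tensor model of Temperley–Lieb recoupling theory (conventions of KL94 §8.2, §9). [folklore] -/
@[simp] theorem zero_tensR (Y : Raw K) : tensR n m 0 Y = 0 := by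
  funext s t; simp [tensR_apply]

/-- Bookkeeping lemma `compR_add` of the binor tensor model of Temperley–Lieb recoupling theory (conventions of KL94 §8.2, §9). [folklore] -/
theorem compR_add (X Y Y' : Raw K) : compR n X (Y + Y') = compR n X Y + compR n X Y' := by
  funext s t; simp [compR_apply, mul_add, Finset.sum_add_distrib]

/-- Bookkeeping lemma `add_compR` of the binor tensor model of Temperley–Lieb recoupling theory (conventions of KL94 §8.2, §9). [folklore] -/
theorem add_compR (X X' Y : Raw K) : compR n (X + X') Y = compR n X Y + compR n X' Y := by
  funext s t; simp [compR_apply, add_mul, Finset.sum_add_distrib]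

/-- Bookkeeping lemma `compR_sub` of the binor tensor model of Temperley–Lieb recoupling theory (conventions of KL94 §8.2, §9). [folklore] -/
theorem compR_sub (X Y Y' : Raw K) : compR n X (Y - Y') = compR n X Y - compR n X Y' := by
  funext s t; simp [compR_apply, mul_sub, Finset.sum_sub_distrib]

/-- Bookkeeping lemma `sub_compR` of the binor tensor model of Temperley–Lieb recoupling theory (conventions of KL94 §8.2, §9). [folklore] -/
theorem sub_compR (X X' Y : Raw K) : compR n (X - X') Y = compR n X Y - compR n X' Y := by
  funext s t; simp [compR_apply, sub_mul, Finset.sum_sub_distrib]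

/-- Bookkeeping lemma `compR_smul` of the binor tensor model of Temperley–Lieb recoupling theory (conventions of KL94 §8.2, §9). [folklore] -/
theorem compR_smul (X : Raw K) (c : K) (Y : Raw K) : compR n X (c • Y) = c • compR n X Y := by
  funext s t; simp [compR_apply, Finset.mul_sum]; exact Finset.sum_congr rfl (fun _ _ => by ring)

/-- Bookkeeping lemma `smul_compR` of the binor tensor model of Temperley–Lieb recoupling theory (conventions of KL94 §8.2, §9). [folklore] -/
theorem smul_compR (c : K) (X Y : Raw K) : compR n (c • X) Y = c • compR n X Y := by
  funext s t; simp [compR_apply, Finset.mul_sum]; exact Finset.sum_congr rfl (fun _ _ => by ring)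

/-- Bookkeeping lemma `compR_zero` of the binor tensor model of Temperley–Lieb recoupling theory (conventions of KL94 §8.2, §9). [folklore] -/
@[simp] theorem compR_zero (X : Raw K) : compR n X 0 = 0 := by
  funext s t; simp [compR_apply]

/-- Bookkeeping lemma `zero_compR` of the binor tensor model of Temperley–Lieb recoupling theory (conventions of KL94 §8.2, §9). [folklore] -/
@[simp] theorem zero_compR (Y : Raw K) : compR n 0 Y = 0 := by
  funext s t; simp [compR_apply]

/-- Bookkeeping lemma `compR_sum` of the binor tensor model of Temperley–Lieb recoupling theory (conventions of KL94 §8.2, §9). [folklore] -/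
theorem compR_sum {ι : Type*} (S : Finset ι) (X : Raw K) (Y : ι → Raw K) :
    compR n X (∑ i ∈ S, Y i) = ∑ i ∈ S, compR n X (Y i) := by
  induction S using Finset.cons_induction with
  | empty => simp
  | cons a S ha ih => rw [Finset.sum_cons, Finset.sum_cons, compR_add, ih]

/-- Bookkeeping lemma `sum_compR` of the binor tensor model of Temperley–Lieb recoupling theory (conventions of KL94 §8.2, §9). [folklore] -/
theorem sum_compR {ι : Type*} (S : Finset ι) (X : ι → Raw K) (Y : Raw K) :
    compR n (∑ i ∈ S, X i) Y = ∑ i ∈ S, compR n (X i) Y := by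
  induction S using Finset.cons_induction with
  | empty => simp
  | cons a S ha ih => rw [Finset.sum_cons, Finset.sum_cons, add_compR, ih]

/-! ### Small explicit sums -/

/-- Bookkeeping lemma `sum_fin_succ` of the binor tensor model of Temperley–Lieb recoupling theory (conventions of KL94 §8.2, §9). [folklore] -/
theorem sum_fin_succ {M : Type*} [AddCommMonoid M] {k : ℕ} (F : (Fin (k + 1) → Bool) → M) :
    ∑ u, F u = ∑ v : Fin k → Bool, (F (Fin.cons false v) + F (Fin.cons true v)) := by
  rw [← Equiv.sum_comp (Fin.consEquiv fun _ : Fin (k + 1) => Bool) F, Fintype.sum_prod_type,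
    Fintype.sum_bool, ← Finset.sum_add_distrib]
  refine Finset.sum_congr rfl (fun v _ => ?_)
  rw [add_comm]
  rfl

/-- Bookkeeping lemma `sum_fin_zero` of the binor tensor model of Temperley–Lieb recoupling theory (conventions of KL94 §8.2, §9). [folklore] -/
theorem sum_fin_zero {M : Type*} [AddCommMonoid M] (F : (Fin 0 → Bool) → M) :
    ∑ u, F u = F (fun i => i.elim0) := by
  rw [Fintype.sum_unique]
  congr 1

/-- Bookkeeping lemma `pad_fin_zero` of the binor tensor model of Temperley–Lieb recoupling theory (conventions of KL94 §8.2, §9). [folklore] -/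
@[simp] theorem pad_fin_zero (u : Fin 0 → Bool) : pad u = fun _ => false := by
  funext i; simp [pad]

/-- Bookkeeping lemma `pad_cons_zero` of the binor tensor model of Temperley–Lieb recoupling theory (conventions of KL94 §8.2, §9). [folklore] -/
@[simp] theorem pad_cons_zero {k : ℕ} (b : Bool) (v : Fin k → Bool) : pad (Fin.cons b v) 0 = b := by
  simp [pad]

/-- Bookkeeping lemma `pad_cons_succ` of the binor tensor model of Temperley–Lieb recoupling theory (conventions of KL94 §8.2, §9). [folklore] -/
@[simp] theorem pad_cons_succ {k : ℕ} (b : Bool) (v : Fin k → Bool) (i : ℕ) :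
    pad (Fin.cons b v) (i + 1) = pad v i := by
  by_cases h : i < k
  · rw [pad_apply_lt _ h, pad_apply_lt _ (by omega)]
    exact Fin.cons_succ (α := fun _ => Bool) b v ⟨i, h⟩
  · rw [pad_apply_ge _ (by omega), pad_apply_ge _ (by omega)]

/-- Bookkeeping lemma `agree_zero` of the binor tensor model of Temperley–Lieb recoupling theory (conventions of KL94 §8.2, §9). [folklore] -/
theorem agree_zero (s t : Idx) : Agree 0 s t := fun i hi => absurd hi (Nat.not_lt_zero i)

/-- Bookkeeping lemma `agree_one_iff` of the binor tensor model of Temperley–Lieb recoupling theory (conventions of KL94 §8.2, §9). [folklore] -/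
theorem agree_one_iff (s t : Idx) : Agree 1 s t ↔ s 0 = t 0 := by
  constructor
  · intro h; exact h 0 Nat.zero_lt_one
  · intro h i hi
    have : i = 0 := by omega
    subst this; exact h

/-- Bookkeeping lemma `agree_two_iff` of the binor tensor model of Temperley–Lieb recoupling theory (conventions of KL94 §8.2, §9). [folklore] -/
theorem agree_two_iff (s t : Idx) : Agree 2 s t ↔ s 0 = t 0 ∧ s 1 = t 1 := by
  constructor
  · intro h; exact ⟨h 0 (by norm_num), h 1 (by norm_num)⟩
  · rintro ⟨h0, h1⟩ i hi
    interval_cases i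
    · exact h0
    · exact h1

/-! ### Cup and cap (the `ε` spinors of the binor calculus) -/

/-- Entries of the cap `ε_{ab}`: `ε_{+-} = A`, `ε_{-+} = -A⁻¹`. [cite: KauffmanLins1994, §8.2] -/
def capv (A : K) : Bool → Bool → K
  | true, false => A
  | false, true => -A⁻¹
  | _, _ => 0

/-- Entries of the cup `ε^{ab} = (ε⁻¹)`: `ε^{+-} = -A`, `ε^{-+} = A⁻¹`. [cite: KauffmanLins1994, §8.2] -/
def cupv (A : K) : Bool → Bool → K
  | true, false => -A
  | false, true => A⁻¹
  | _, _ => 0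

/-- Bookkeeping lemma `capv_tt` of the binor tensor model of Temperley–Lieb recoupling theory (conventions of KL94 §8.2, §9). [folklore] -/
@[simp] theorem capv_tt (A : K) : capv A true true = 0 := rfl
/-- Bookkeeping lemma `capv_tf` of the binor tensor model of Temperley–Lieb recoupling theory (conventions of KL94 §8.2, §9). [folklore] -/
@[simp] theorem capv_tf (A : K) : capv A true false = A := rfl
/-- Bookkeeping lemma `capv_ft` of the binor tensor model of Temperley–Lieb recoupling theory (conventions of KL94 §8.2, §9). [folklore] -/
@[simp] theorem capv_ft (A : K) : capv A false true = -A⁻¹ := rfl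
/-- Bookkeeping lemma `capv_ff` of the binor tensor model of Temperley–Lieb recoupling theory (conventions of KL94 §8.2, §9). [folklore] -/
@[simp] theorem capv_ff (A : K) : capv A false false = 0 := rfl
/-- Bookkeeping lemma `cupv_tt` of the binor tensor model of Temperley–Lieb recoupling theory (conventions of KL94 §8.2, §9). [folklore] -/
@[simp] theorem cupv_tt (A : K) : cupv A true true = 0 := rfl
/-- Bookkeeping lemma `cupv_tf` of the binor tensor model of Temperley–Lieb recoupling theory (conventions of KL94 §8.2, §9). [folklore] -/
@[simp] theorem cupv_tf (A : K) : cupv A true false = -A := rfl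
/-- Bookkeeping lemma `cupv_ft` of the binor tensor model of Temperley–Lieb recoupling theory (conventions of KL94 §8.2, §9). [folklore] -/
@[simp] theorem cupv_ft (A : K) : cupv A false true = A⁻¹ := rfl
/-- Bookkeeping lemma `cupv_ff` of the binor tensor model of Temperley–Lieb recoupling theory (conventions of KL94 §8.2, §9). [folklore] -/
@[simp] theorem cupv_ff (A : K) : cupv A false false = 0 := rfl

/-- The cap `∩ : 2 → 0` (raw). [cite: KauffmanLins1994, §8.2, §9.1] -/
def capR (A : K) : Raw K := fun _ t => capv A (t 0) (t 1)

/-- The cup `∪ : 0 → 2` (raw). [cite: KauffmanLins1994, §8.2, §9.1] -/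
def cupR (A : K) : Raw K := fun s _ => cupv A (s 0) (s 1)

/-- Bookkeeping lemma `capR_apply` of the binor tensor model of Temperley–Lieb recoupling theory (conventions of KL94 §8.2, §9). [folklore] -/
@[simp] theorem capR_apply (A : K) (s t : Idx) : capR A s t = capv A (t 0) (t 1) := rfl

/-- Bookkeeping lemma `cupR_apply` of the binor tensor model of Temperley–Lieb recoupling theory (conventions of KL94 §8.2, §9). [folklore] -/
@[simp] theorem cupR_apply (A : K) (s t : Idx) : cupR A s t = cupv A (s 0) (s 1) := rfl

/-- Bookkeeping lemma `capR` of the binor tensor model of Temperley–Lieb recoupling theory (conventions of KL94 §8.2, §9). [folklore] -/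
theorem RespR.capR (A : K) (n : ℕ) : RespR n (capR A) := fun _ _ _ _ => rfl

/-- Bookkeeping lemma `capR` of the binor tensor model of Temperley–Lieb recoupling theory (conventions of KL94 §8.2, §9). [folklore] -/
theorem RespC.capR (A : K) : RespC 2 (capR A) := fun s t t' h => by
  rw [agree_two_iff] at h; simp [h.1, h.2]

/-- Bookkeeping lemma `cupR` of the binor tensor model of Temperley–Lieb recoupling theory (conventions of KL94 §8.2, §9). [folklore] -/
theorem RespC.cupR (A : K) (m : ℕ) : RespC m (cupR A) := fun _ _ _ _ => rfl

/-- Bookkeeping lemma `cupR` of the binor tensor model of Temperley–Lieb recoupling theory (conventions of KL94 §8.2, §9). [folklore] -/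
theorem RespR.cupR (A : K) : RespR 2 (cupR A) := fun s s' t h => by
  rw [agree_two_iff] at h; simp [h.1, h.2]

/-- The loop value `d = -A² - A⁻²`. [cite: KauffmanLins1994, §9.1] -/
def dval (A : K) : K := -A ^ 2 - A⁻¹ ^ 2

/-- A closed loop evaluates to `d`: `∩ ∘ ∪ = d`. [cite: KauffmanLins1994, §9.1] -/
theorem capR_cupR (A : K) : compR 2 (capR A) (cupR A) = dval A • idR 0 := by
  funext s t
  simp only [compR_apply, capR_apply, cupR_apply, sum_fin_succ, sum_fin_zero, pad_cons_zero,
    pad_cons_succ, idR_zero, Pi.smul_apply, smul_eq_mul, mul_one]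
  simp [dval]
  ring

/-- Zig-zag identity `(𝟙 ⊗ ∩)(∪ ⊗ 𝟙) = 𝟙` (raw). [folklore] -/
theorem zigzagR_left (A : K) (hA : A ≠ 0) :
    compR 3 (tensR 1 1 (idR 1) (capR A)) (tensR 2 0 (cupR A) (idR 1)) = idR 1 := by
  funext s t
  simp only [compR_apply, tensR_apply, idR_apply, agree_one_iff, capR_apply, cupR_apply,
    shift_apply, sum_fin_succ, sum_fin_zero, pad_cons_zero, pad_cons_succ, Nat.add_zero,
    show (1 : ℕ) + 1 = 2 from rfl]
  cases s 0 <;> cases t 0 <;> simp [hA]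

/-- Zig-zag identity `(∩ ⊗ 𝟙)(𝟙 ⊗ ∪) = 𝟙` (raw). [folklore] -/
theorem zigzagR_right (A : K) (hA : A ≠ 0) :
    compR 3 (tensR 0 2 (capR A) (idR 1)) (tensR 1 1 (idR 1) (cupR A)) = idR 1 := by
  funext s t
  simp only [compR_apply, tensR_apply, idR_apply, agree_one_iff, capR_apply, cupR_apply,
    shift_apply, sum_fin_succ, sum_fin_zero, pad_cons_zero, pad_cons_succ,
    show (1 : ℕ) + 1 = 2 from rfl, show (0 : ℕ) + 0 = 0 from rfl, show (0:ℕ) + 1 = 1 from rfl]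
  cases s 0 <;> cases t 0 <;> simp [hA]

/-! ### Transpose (up–down mirror) -/

/-- Transpose of a raw morphism (reflection of the diagram in a horizontal line). [folklore] -/
def trp (X : Raw K) : Raw K := fun s t => X t s

/-- Bookkeeping lemma `trp_apply` of the binor tensor model of Temperley–Lieb recoupling theory (conventions of KL94 §8.2, §9). [folklore] -/
@[simp] theorem trp_apply (X : Raw K) (s t : Idx) : trp X s t = X t s := rfl

/-- Bookkeeping lemma `trp_trp` of the binor tensor model of Temperley–Lieb recoupling theory (conventions of KL94 §8.2, §9). [folklore] -/
@[simp] theorem trp_trp (X : Raw K) : trp (trp X) = X := rfl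

/-- Bookkeeping lemma `trp_compR` of the binor tensor model of Temperley–Lieb recoupling theory (conventions of KL94 §8.2, §9). [folklore] -/
theorem trp_compR (X Y : Raw K) : trp (compR n X Y) = compR n (trp Y) (trp X) := by
  funext s t; simp only [trp_apply, compR_apply]; exact Finset.sum_congr rfl (fun _ _ => mul_comm _ _)

/-- Bookkeeping lemma `trp_tensR` of the binor tensor model of Temperley–Lieb recoupling theory (conventions of KL94 §8.2, §9). [folklore] -/
theorem trp_tensR (X Y : Raw K) : trp (tensR n m X Y) = tensR m n (trp X) (trp Y) := rfl

/-- Bookkeeping lemma `trp_idR` of the binor tensor model of Temperley–Lieb recoupling theory (conventions of KL94 §8.2, §9). [folklore] -/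
@[simp] theorem trp_idR (n : ℕ) : trp (idR (K := K) n) = idR n := by
  funext s t
  simp only [trp_apply, idR_apply]
  by_cases h : Agree n s t
  · rw [if_pos h, if_pos h.symm]
  · rw [if_neg h, if_neg (fun h' => h h'.symm)]

/-- Bookkeeping lemma `trp_capR` of the binor tensor model of Temperley–Lieb recoupling theory (conventions of KL94 §8.2, §9). [folklore] -/
theorem trp_capR (A : K) : trp (capR A) = -cupR A := by
  funext s t
  simp only [trp_apply, capR_apply, cupR_apply, Pi.neg_apply]
  cases s 0 <;> cases s 1 <;> simp

/-- Bookkeeping lemma `trp_cupR` of the binor tensor model of Temperley–Lieb recoupling theory (conventions of KL94 §8.2, §9). [folklore] -/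
theorem trp_cupR (A : K) : trp (cupR A) = -capR A := by
  funext s t
  simp only [trp_apply, capR_apply, cupR_apply, Pi.neg_apply]
  cases t 0 <;> cases t 1 <;> simp

/-- Bookkeeping lemma `trp_add` of the binor tensor model of Temperley–Lieb recoupling theory (conventions of KL94 §8.2, §9). [folklore] -/
theorem trp_add (X Y : Raw K) : trp (X + Y) = trp X + trp Y := rfl
/-- Bookkeeping lemma `trp_sub` of the binor tensor model of Temperley–Lieb recoupling theory (conventions of KL94 §8.2, §9). [folklore] -/
theorem trp_sub (X Y : Raw K) : trp (X - Y) = trp X - trp Y := rfl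
/-- Bookkeeping lemma `trp_smul` of the binor tensor model of Temperley–Lieb recoupling theory (conventions of KL94 §8.2, §9). [folklore] -/
theorem trp_smul (c : K) (X : Raw K) : trp (c • X) = c • trp X := rfl
/-- Bookkeeping lemma `trp_neg` of the binor tensor model of Temperley–Lieb recoupling theory (conventions of KL94 §8.2, §9). [folklore] -/
theorem trp_neg (X : Raw K) : trp (-X) = -trp X := rfl
/-- Bookkeeping lemma `trp_zero` of the binor tensor model of Temperley–Lieb recoupling theory (conventions of KL94 §8.2, §9). [folklore] -/
@[simp] theorem trp_zero : trp (0 : Raw K) = 0 := rfl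

/-- Bookkeeping lemma `trp` of the binor tensor model of Temperley–Lieb recoupling theory (conventions of KL94 §8.2, §9). [folklore] -/
theorem RespC.trp {X : Raw K} (h : RespC m X) : RespR m (trp X) := fun _ _ t hs => h t hs
/-- Bookkeeping lemma `trp` of the binor tensor model of Temperley–Lieb recoupling theory (conventions of KL94 §8.2, §9). [folklore] -/
theorem RespR.trp {X : Raw K} (h : RespR n X) : RespC n (trp X) := fun s _ _ ht => h s ht

/-! ### Typed morphisms `m → n` -/

variable (K) in
/-- Morphisms `m → n` of the tensor (binor) model of the Temperley–Lieb category: raw matrices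
reading only the first `n` output bits and the first `m` input bits.
[cite: KauffmanLins1994, §8.2] -/
structure Mor (m n : ℕ) where
  /-- the underlying raw matrix -/
  val : Raw K
  /-- only the first `m` input bits are read -/
  respC : RespC m val
  /-- only the first `n` output bits are read -/
  respR : RespR n val

namespace Mor

/-- Bookkeeping lemma `val_injective` of the binor tensor model of Temperley–Lieb recoupling theory (conventions of KL94 §8.2, §9). [folklore] -/
theorem val_injective : Function.Injective (val : Mor K m n → Raw K) := by
  rintro ⟨_, _, _⟩ ⟨_, _, _⟩ h; congr

/-- Bookkeeping lemma `ext'` of the binor tensor model of Temperley–Lieb recoupling theory (conventions of KL94 §8.2, §9). [folklore] -/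
theorem ext' {X Y : Mor K m n} (h : X.val = Y.val) : X = Y := val_injective h

/-- Decidability instance (by unfolding the definition). [folklore] -/
instance : Zero (Mor K m n) := ⟨⟨0, RespC.zero m, RespR.zero n⟩⟩
/-- Decidability instance (by unfolding the definition). [folklore] -/
instance : Add (Mor K m n) := ⟨fun X Y => ⟨X.val + Y.val, X.respC.add Y.respC, X.respR.add Y.respR⟩⟩
/-- Decidability instance (by unfolding the definition). [folklore] -/
instance : Neg (Mor K m n) := ⟨fun X => ⟨-X.val, X.respC.neg, X.respR.neg⟩⟩
/-- Decidability instance (by unfolding the definition). [folklore] -/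
instance : Sub (Mor K m n) := ⟨fun X Y => ⟨X.val - Y.val, X.respC.sub Y.respC, X.respR.sub Y.respR⟩⟩
/-- Decidability instance (by unfolding the definition). [folklore] -/
instance : SMul K (Mor K m n) := ⟨fun c X => ⟨c • X.val, X.respC.smul c, X.respR.smul c⟩⟩
/-- Decidability instance (by unfolding the definition). [folklore] -/
instance : SMul ℕ (Mor K m n) := ⟨fun c X => ⟨c • X.val, X.respC.smul c, X.respR.smul c⟩⟩
/-- Decidability instance (by unfolding the definition). [folklore] -/
instance : SMul ℤ (Mor K m n) := ⟨fun c X => ⟨c • X.val, X.respC.smul c, X.respR.smul c⟩⟩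

/-- Decidability instance (by unfolding the definition). [folklore] -/
instance : AddCommGroup (Mor K m n) :=
  val_injective.addCommGroup val rfl (fun _ _ => rfl) (fun _ => rfl) (fun _ _ => rfl)
    (fun _ _ => rfl) (fun _ _ => rfl)

/-- The underlying-matrix map as an additive homomorphism. [folklore] -/
def valHom : Mor K m n →+ Raw K where
  toFun := val
  map_zero' := rfl
  map_add' _ _ := rfl

/-- Decidability instance (by unfolding the definition). [folklore] -/
instance : Module K (Mor K m n) := val_injective.module K valHom (fun _ _ => rfl)

/-- Composition `X ∘ Y` (first `Y`, then `X`). [folklore] -/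
def comp (X : Mor K n p) (Y : Mor K m n) : Mor K m p :=
  ⟨compR n X.val Y.val, Y.respC.compR n X.val, X.respR.compR n Y.val⟩

/-- Tensor product (juxtaposition). [folklore] -/
def tens (X : Mor K m n) (Y : Mor K m' n') : Mor K (m + m') (n + n') :=
  ⟨tensR n m X.val Y.val, X.respC.tensR Y.respC n, X.respR.tensR Y.respR m⟩

/-- Identity on `n` strands. [folklore] -/
def idm (n : ℕ) : Mor K n n := ⟨idR n, RespC.idR n, RespR.idR n⟩

/-- Transport along equalities of strand numbers (the underlying matrix is unchanged). [folklore] -/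
def cast (X : Mor K m n) (hm : m = m') (hn : n = n') : Mor K m' n' :=
  ⟨X.val, hm ▸ X.respC, hn ▸ X.respR⟩

/-- The cap `∩ : 2 → 0`. [cite: KauffmanLins1994, §9.1] -/
def cap (A : K) : Mor K 2 0 := ⟨capR A, RespC.capR A, RespR.capR A 0⟩

/-- The cup `∪ : 0 → 2`. [cite: KauffmanLins1994, §9.1] -/
def cup (A : K) : Mor K 0 2 := ⟨cupR A, RespC.cupR A 0, RespR.cupR A⟩

/-- Transpose (mirror in a horizontal line). [folklore] -/
def trpm (X : Mor K m n) : Mor K n m := ⟨trp X.val, X.respR.trp, X.respC.trp⟩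

@[inherit_doc] scoped infixl:80 " ⊚ " => Mor.comp
@[inherit_doc] scoped infixl:70 " ⊗ₘ " => Mor.tens

/-- Bookkeeping lemma `comp_val` of the binor tensor model of Temperley–Lieb recoupling theory (conventions of KL94 §8.2, §9). [folklore] -/
@[simp] theorem comp_val (X : Mor K n p) (Y : Mor K m n) : (X ⊚ Y).val = compR n X.val Y.val := rfl
/-- Bookkeeping lemma `tens_val` of the binor tensor model of Temperley–Lieb recoupling theory (conventions of KL94 §8.2, §9). [folklore] -/
@[simp] theorem tens_val (X : Mor K m n) (Y : Mor K m' n') : (X ⊗ₘ Y).val = tensR n m X.val Y.val := rfl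
/-- Bookkeeping lemma `idm_val` of the binor tensor model of Temperley–Lieb recoupling theory (conventions of KL94 §8.2, §9). [folklore] -/
@[simp] theorem idm_val (n : ℕ) : (idm n : Mor K n n).val = idR n := rfl
/-- Bookkeeping lemma `cast_val` of the binor tensor model of Temperley–Lieb recoupling theory (conventions of KL94 §8.2, §9). [folklore] -/
@[simp] theorem cast_val (X : Mor K m n) (hm : m = m') (hn : n = n') : (X.cast hm hn).val = X.val := rfl
/-- Bookkeeping lemma `cap_val` of the binor tensor model of Temperley–Lieb recoupling theory (conventions of KL94 §8.2, §9). [folklore] -/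
@[simp] theorem cap_val (A : K) : (cap A).val = capR A := rfl
/-- Bookkeeping lemma `cup_val` of the binor tensor model of Temperley–Lieb recoupling theory (conventions of KL94 §8.2, §9). [folklore] -/
@[simp] theorem cup_val (A : K) : (cup A).val = cupR A := rfl
/-- Bookkeeping lemma `trpm_val` of the binor tensor model of Temperley–Lieb recoupling theory (conventions of KL94 §8.2, §9). [folklore] -/
@[simp] theorem trpm_val (X : Mor K m n) : (trpm X).val = trp X.val := rfl
/-- Bookkeeping lemma `add_val` of the binor tensor model of Temperley–Lieb recoupling theory (conventions of KL94 §8.2, §9). [folklore] -/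
theorem add_val (X Y : Mor K m n) : (X + Y).val = X.val + Y.val := rfl
/-- Bookkeeping lemma `sub_val` of the binor tensor model of Temperley–Lieb recoupling theory (conventions of KL94 §8.2, §9). [folklore] -/
theorem sub_val (X Y : Mor K m n) : (X - Y).val = X.val - Y.val := rfl
/-- Bookkeeping lemma `smul_val` of the binor tensor model of Temperley–Lieb recoupling theory (conventions of KL94 §8.2, §9). [folklore] -/
theorem smul_val (c : K) (X : Mor K m n) : (c • X).val = c • X.val := rfl
/-- Bookkeeping lemma `neg_val` of the binor tensor model of Temperley–Lieb recoupling theory (conventions of KL94 §8.2, §9). [folklore] -/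
theorem neg_val (X : Mor K m n) : (-X).val = -X.val := rfl
/-- Bookkeeping lemma `zero_val` of the binor tensor model of Temperley–Lieb recoupling theory (conventions of KL94 §8.2, §9). [folklore] -/
theorem zero_val : (0 : Mor K m n).val = 0 := rfl
/-- Bookkeeping lemma `sum_val` of the binor tensor model of Temperley–Lieb recoupling theory (conventions of KL94 §8.2, §9). [folklore] -/
theorem sum_val {ι : Type*} (S : Finset ι) (X : ι → Mor K m n) :
    (∑ i ∈ S, X i).val = ∑ i ∈ S, (X i).val := map_sum (valHom : Mor K m n →+ Raw K) X S

/-- Bookkeeping lemma `cast_rfl` of the binor tensor model of Temperley–Lieb recoupling theory (conventions of KL94 §8.2, §9). [folklore] -/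
@[simp] theorem cast_rfl (X : Mor K m n) : X.cast rfl rfl = X := rfl

/-- Bookkeeping lemma `cast_cast` of the binor tensor model of Temperley–Lieb recoupling theory (conventions of KL94 §8.2, §9). [folklore] -/
@[simp] theorem cast_cast (X : Mor K m n) (hm : m = m') (hn : n = n') (hm' : m' = m'')
    (hn' : n' = n'') : (X.cast hm hn).cast hm' hn' = X.cast (hm.trans hm') (hn.trans hn') := rfl

/-! #### Laws (typed) -/

/-- Bookkeeping lemma `comp_assoc` of the binor tensor model of Temperley–Lieb recoupling theory (conventions of KL94 §8.2, §9). [folklore] -/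
theorem comp_assoc (X : Mor K n p) (Y : Mor K m n) (Z : Mor K m' m) :
    X ⊚ (Y ⊚ Z) = X ⊚ Y ⊚ Z := ext' (compR_assoc _ _ _)

/-- Bookkeeping lemma `idm_comp` of the binor tensor model of Temperley–Lieb recoupling theory (conventions of KL94 §8.2, §9). [folklore] -/
@[simp] theorem idm_comp (Y : Mor K m n) : idm n ⊚ Y = Y := ext' (idR_compR Y.respR)

/-- Bookkeeping lemma `comp_idm` of the binor tensor model of Temperley–Lieb recoupling theory (conventions of KL94 §8.2, §9). [folklore] -/
@[simp] theorem comp_idm (X : Mor K m n) : X ⊚ idm m = X := ext' (compR_idR X.respC)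

/-- Interchange law `(X ⊗ Y)(X' ⊗ Y') = XX' ⊗ YY'`. [folklore] -/
theorem tens_comp_tens (X : Mor K n p) (Y : Mor K n' p') (X' : Mor K m n) (Y' : Mor K m' n') :
    (X ⊗ₘ Y) ⊚ (X' ⊗ₘ Y') = (X ⊚ X') ⊗ₘ (Y ⊚ Y') := ext' (compR_tensR_tensR X.respC X'.respR)

/-- Bookkeeping lemma `tens_assoc` of the binor tensor model of Temperley–Lieb recoupling theory (conventions of KL94 §8.2, §9). [folklore] -/
theorem tens_assoc (X : Mor K m n) (Y : Mor K m' n') (Z : Mor K m'' n'') :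
    X ⊗ₘ (Y ⊗ₘ Z) = (X ⊗ₘ Y ⊗ₘ Z).cast (Nat.add_assoc _ _ _) (Nat.add_assoc _ _ _) :=
  ext' (tensR_assoc _ _ _)

/-- Bookkeeping lemma `idm_tens_idm` of the binor tensor model of Temperley–Lieb recoupling theory (conventions of KL94 §8.2, §9). [folklore] -/
@[simp] theorem idm_tens_idm (n n' : ℕ) : (idm n ⊗ₘ idm n' : Mor K _ _) = idm (n + n') :=
  ext' (tensR_idR_idR n n')

/-- Bookkeeping lemma `tens_idm_zero` of the binor tensor model of Temperley–Lieb recoupling theory (conventions of KL94 §8.2, §9). [folklore] -/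
@[simp] theorem tens_idm_zero (X : Mor K m n) : X ⊗ₘ idm 0 = X :=
  ext' (tensR_idR_zero (n := n) (m := m) _)

/-- Bookkeeping lemma `idm_zero_tens` of the binor tensor model of Temperley–Lieb recoupling theory (conventions of KL94 §8.2, §9). [folklore] -/
theorem idm_zero_tens (X : Mor K m n) :
    idm 0 ⊗ₘ X = X.cast (Nat.zero_add m).symm (Nat.zero_add n).symm :=
  ext' (tensR_zero_zero_idR_zero _)

/-- Bookkeeping lemma `tens_add` of the binor tensor model of Temperley–Lieb recoupling theory (conventions of KL94 §8.2, §9). [folklore] -/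
theorem tens_add (X : Mor K m n) (Y Y' : Mor K m' n') : X ⊗ₘ (Y + Y') = X ⊗ₘ Y + X ⊗ₘ Y' :=
  ext' (tensR_add _ _ _)
/-- Bookkeeping lemma `add_tens` of the binor tensor model of Temperley–Lieb recoupling theory (conventions of KL94 §8.2, §9). [folklore] -/
theorem add_tens (X X' : Mor K m n) (Y : Mor K m' n') : (X + X') ⊗ₘ Y = X ⊗ₘ Y + X' ⊗ₘ Y :=
  ext' (add_tensR _ _ _)
/-- Bookkeeping lemma `tens_sub` of the binor tensor model of Temperley–Lieb recoupling theory (conventions of KL94 §8.2, §9). [folklore] -/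
theorem tens_sub (X : Mor K m n) (Y Y' : Mor K m' n') : X ⊗ₘ (Y - Y') = X ⊗ₘ Y - X ⊗ₘ Y' :=
  ext' (tensR_sub _ _ _)
/-- Bookkeeping lemma `sub_tens` of the binor tensor model of Temperley–Lieb recoupling theory (conventions of KL94 §8.2, §9). [folklore] -/
theorem sub_tens (X X' : Mor K m n) (Y : Mor K m' n') : (X - X') ⊗ₘ Y = X ⊗ₘ Y - X' ⊗ₘ Y :=
  ext' (sub_tensR _ _ _)
/-- Bookkeeping lemma `tens_smul` of the binor tensor model of Temperley–Lieb recoupling theory (conventions of KL94 §8.2, §9). [folklore] -/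
theorem tens_smul (X : Mor K m n) (c : K) (Y : Mor K m' n') : X ⊗ₘ (c • Y) = c • (X ⊗ₘ Y) :=
  ext' (tensR_smul _ _ _)
/-- Bookkeeping lemma `smul_tens` of the binor tensor model of Temperley–Lieb recoupling theory (conventions of KL94 §8.2, §9). [folklore] -/
theorem smul_tens (c : K) (X : Mor K m n) (Y : Mor K m' n') : (c • X) ⊗ₘ Y = c • (X ⊗ₘ Y) :=
  ext' (smul_tensR _ _ _)
/-- Bookkeeping lemma `tens_zero` of the binor tensor model of Temperley–Lieb recoupling theory (conventions of KL94 §8.2, §9). [folklore] -/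
@[simp] theorem tens_zero (X : Mor K m n) : X ⊗ₘ (0 : Mor K m' n') = 0 := ext' (tensR_zero _)
/-- Bookkeeping lemma `zero_tens` of the binor tensor model of Temperley–Lieb recoupling theory (conventions of KL94 §8.2, §9). [folklore] -/
@[simp] theorem zero_tens (Y : Mor K m' n') : (0 : Mor K m n) ⊗ₘ Y = 0 := ext' (zero_tensR _)

/-- Bookkeeping lemma `comp_add` of the binor tensor model of Temperley–Lieb recoupling theory (conventions of KL94 §8.2, §9). [folklore] -/
theorem comp_add (X : Mor K n p) (Y Y' : Mor K m n) : X ⊚ (Y + Y') = X ⊚ Y + X ⊚ Y' :=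
  ext' (compR_add _ _ _)
/-- Bookkeeping lemma `add_comp` of the binor tensor model of Temperley–Lieb recoupling theory (conventions of KL94 §8.2, §9). [folklore] -/
theorem add_comp (X X' : Mor K n p) (Y : Mor K m n) : (X + X') ⊚ Y = X ⊚ Y + X' ⊚ Y :=
  ext' (add_compR _ _ _)
/-- Bookkeeping lemma `comp_sub` of the binor tensor model of Temperley–Lieb recoupling theory (conventions of KL94 §8.2, §9). [folklore] -/
theorem comp_sub (X : Mor K n p) (Y Y' : Mor K m n) : X ⊚ (Y - Y') = X ⊚ Y - X ⊚ Y' :=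
  ext' (compR_sub _ _ _)
/-- Bookkeeping lemma `sub_comp` of the binor tensor model of Temperley–Lieb recoupling theory (conventions of KL94 §8.2, §9). [folklore] -/
theorem sub_comp (X X' : Mor K n p) (Y : Mor K m n) : (X - X') ⊚ Y = X ⊚ Y - X' ⊚ Y :=
  ext' (sub_compR _ _ _)
/-- Bookkeeping lemma `comp_smul` of the binor tensor model of Temperley–Lieb recoupling theory (conventions of KL94 §8.2, §9). [folklore] -/
theorem comp_smul (X : Mor K n p) (c : K) (Y : Mor K m n) : X ⊚ (c • Y) = c • (X ⊚ Y) :=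
  ext' (compR_smul _ _ _)
/-- Bookkeeping lemma `smul_comp` of the binor tensor model of Temperley–Lieb recoupling theory (conventions of KL94 §8.2, §9). [folklore] -/
theorem smul_comp (c : K) (X : Mor K n p) (Y : Mor K m n) : (c • X) ⊚ Y = c • (X ⊚ Y) :=
  ext' (smul_compR _ _ _)
/-- Bookkeeping lemma `comp_zero` of the binor tensor model of Temperley–Lieb recoupling theory (conventions of KL94 §8.2, §9). [folklore] -/
@[simp] theorem comp_zero (X : Mor K n p) : X ⊚ (0 : Mor K m n) = 0 := ext' (compR_zero _)
/-- Bookkeeping lemma `zero_comp` of the binor tensor model of Temperley–Lieb recoupling theory (conventions of KL94 §8.2, §9). [folklore] -/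
@[simp] theorem zero_comp (Y : Mor K m n) : (0 : Mor K n p) ⊚ Y = 0 := ext' (zero_compR _)

/-- Bookkeeping lemma `comp_sum` of the binor tensor model of Temperley–Lieb recoupling theory (conventions of KL94 §8.2, §9). [folklore] -/
theorem comp_sum {ι : Type*} (S : Finset ι) (X : Mor K n p) (Y : ι → Mor K m n) :
    X ⊚ (∑ i ∈ S, Y i) = ∑ i ∈ S, X ⊚ Y i := by
  apply ext'; rw [comp_val, sum_val, sum_val, compR_sum]; rfl

/-- Bookkeeping lemma `sum_comp` of the binor tensor model of Temperley–Lieb recoupling theory (conventions of KL94 §8.2, §9). [folklore] -/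
theorem sum_comp {ι : Type*} (S : Finset ι) (X : ι → Mor K n p) (Y : Mor K m n) :
    (∑ i ∈ S, X i) ⊚ Y = ∑ i ∈ S, X i ⊚ Y := by
  apply ext'; rw [comp_val, sum_val, sum_val, sum_compR]; rfl

/-- Bookkeeping lemma `cast_comp_cast` of the binor tensor model of Temperley–Lieb recoupling theory (conventions of KL94 §8.2, §9). [folklore] -/
theorem cast_comp_cast (X : Mor K n p) (Y : Mor K m n) (hm : m = m') (hn : n = n') (hp : p = p') :
    X.cast hn hp ⊚ Y.cast hm hn = (X ⊚ Y).cast hm hp := by subst hm hn hp; rfl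

/-- Bookkeeping lemma `cast_tens_cast` of the binor tensor model of Temperley–Lieb recoupling theory (conventions of KL94 §8.2, §9). [folklore] -/
theorem cast_tens_cast (X : Mor K m n) (Y : Mor K m' n') (hm : m = p) (hn : n = p') (hm' : m' = m'')
    (hn' : n' = n'') :
    X.cast hm hn ⊗ₘ Y.cast hm' hn' = (X ⊗ₘ Y).cast (by rw [hm, hm']) (by rw [hn, hn']) := by
  subst hm hn hm' hn'; rfl

/-! #### Cup, cap, zig-zag, loop (typed) -/

/-- Zig-zag identity `(𝟙 ⊗ ∩)(∪ ⊗ 𝟙) = 𝟙`. [folklore] -/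
theorem zigzag_left (A : K) (hA : A ≠ 0) :
    ((idm 1 : Mor K 1 1) ⊗ₘ cap A :) ⊚ (cup A ⊗ₘ (idm 1 : Mor K 1 1) :) = idm 1 :=
  ext' (zigzagR_left A hA)

/-- Zig-zag identity `(∩ ⊗ 𝟙)(𝟙 ⊗ ∪) = 𝟙`. [folklore] -/
theorem zigzag_right (A : K) (hA : A ≠ 0) :
    (cap A ⊗ₘ (idm 1 : Mor K 1 1) :) ⊚ ((idm 1 : Mor K 1 1) ⊗ₘ cup A :) = idm 1 :=
  ext' (zigzagR_right A hA)

/-- The loop: `∩ ∘ ∪ = d · 𝟙₀`. [cite: KauffmanLins1994, §9.1] -/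
theorem cap_cup (A : K) : cap A ⊚ cup A = dval A • idm 0 := ext' (capR_cupR A)

/-! #### Transpose (typed) -/

/-- Bookkeeping lemma `trpm_comp` of the binor tensor model of Temperley–Lieb recoupling theory (conventions of KL94 §8.2, §9). [folklore] -/
theorem trpm_comp (X : Mor K n p) (Y : Mor K m n) : trpm (X ⊚ Y) = trpm Y ⊚ trpm X :=
  ext' (trp_compR _ _)
/-- Bookkeeping lemma `trpm_tens` of the binor tensor model of Temperley–Lieb recoupling theory (conventions of KL94 §8.2, §9). [folklore] -/
theorem trpm_tens (X : Mor K m n) (Y : Mor K m' n') : trpm (X ⊗ₘ Y) = trpm X ⊗ₘ trpm Y := rfl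
/-- Bookkeeping lemma `trpm_idm` of the binor tensor model of Temperley–Lieb recoupling theory (conventions of KL94 §8.2, §9). [folklore] -/
@[simp] theorem trpm_idm (n : ℕ) : trpm (idm n : Mor K n n) = idm n := ext' (trp_idR n)
/-- Bookkeeping lemma `trpm_trpm` of the binor tensor model of Temperley–Lieb recoupling theory (conventions of KL94 §8.2, §9). [folklore] -/
@[simp] theorem trpm_trpm (X : Mor K m n) : trpm (trpm X) = X := rfl
/-- Bookkeeping lemma `trpm_cap` of the binor tensor model of Temperley–Lieb recoupling theory (conventions of KL94 §8.2, §9). [folklore] -/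
theorem trpm_cap (A : K) : trpm (cap A) = -cup A := ext' (trp_capR A)
/-- Bookkeeping lemma `trpm_cup` of the binor tensor model of Temperley–Lieb recoupling theory (conventions of KL94 §8.2, §9). [folklore] -/
theorem trpm_cup (A : K) : trpm (cup A) = -cap A := ext' (trp_cupR A)
/-- Bookkeeping lemma `trpm_add` of the binor tensor model of Temperley–Lieb recoupling theory (conventions of KL94 §8.2, §9). [folklore] -/
theorem trpm_add (X Y : Mor K m n) : trpm (X + Y) = trpm X + trpm Y := rfl
/-- Bookkeeping lemma `trpm_sub` of the binor tensor model of Temperley–Lieb recoupling theory (conventions of KL94 §8.2, §9). [folklore] -/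
theorem trpm_sub (X Y : Mor K m n) : trpm (X - Y) = trpm X - trpm Y := rfl
/-- Bookkeeping lemma `trpm_smul` of the binor tensor model of Temperley–Lieb recoupling theory (conventions of KL94 §8.2, §9). [folklore] -/
theorem trpm_smul (c : K) (X : Mor K m n) : trpm (c • X) = c • trpm X := rfl
/-- Bookkeeping lemma `trpm_neg` of the binor tensor model of Temperley–Lieb recoupling theory (conventions of KL94 §8.2, §9). [folklore] -/
theorem trpm_neg (X : Mor K m n) : trpm (-X) = -trpm X := rfl
/-- Bookkeeping lemma `trpm_zero` of the binor tensor model of Temperley–Lieb recoupling theory (conventions of KL94 §8.2, §9). [folklore] -/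
@[simp] theorem trpm_zero : trpm (0 : Mor K m n) = 0 := rfl

end Mor

namespace Mor

/-! ### Sliding lemmas -/

/-- Bookkeeping lemma `tens_idm_comp_tens_idm` of the binor tensor model of Temperley–Lieb recoupling theory (conventions of KL94 §8.2, §9). [folklore] -/
theorem tens_idm_comp_tens_idm (X : Mor K n p) (Y : Mor K m n) (k : ℕ) :
    (X ⊗ₘ idm k) ⊚ (Y ⊗ₘ idm k) = (X ⊚ Y) ⊗ₘ idm k := by
  rw [tens_comp_tens, idm_comp]

/-- Bookkeeping lemma `idm_tens_comp_idm_tens` of the binor tensor model of Temperley–Lieb recoupling theory (conventions of KL94 §8.2, §9). [folklore] -/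
theorem idm_tens_comp_idm_tens (k : ℕ) (X : Mor K n p) (Y : Mor K m n) :
    (idm k ⊗ₘ X) ⊚ (idm k ⊗ₘ Y) = idm k ⊗ₘ (X ⊚ Y) := by
  rw [tens_comp_tens, idm_comp]

/-- Bookkeeping lemma `tens_idm_comp_idm_tens` of the binor tensor model of Temperley–Lieb recoupling theory (conventions of KL94 §8.2, §9). [folklore] -/
theorem tens_idm_comp_idm_tens (X : Mor K m n) (Y : Mor K m' n') :
    (X ⊗ₘ idm n') ⊚ (idm m ⊗ₘ Y) = X ⊗ₘ Y := by
  rw [tens_comp_tens, idm_comp, comp_idm]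

/-- Bookkeeping lemma `idm_tens_comp_tens_idm` of the binor tensor model of Temperley–Lieb recoupling theory (conventions of KL94 §8.2, §9). [folklore] -/
theorem idm_tens_comp_tens_idm (X : Mor K m n) (Y : Mor K m' n') :
    (idm n ⊗ₘ Y) ⊚ (X ⊗ₘ idm m') = X ⊗ₘ Y := by
  rw [tens_comp_tens, idm_comp, comp_idm]

/-- Sliding: `(X ⊗ 𝟙)(𝟙 ⊗ Y) = (𝟙 ⊗ Y)(X ⊗ 𝟙)`. [folklore] -/
theorem slide (X : Mor K m n) (Y : Mor K m' n') :
    (X ⊗ₘ idm n') ⊚ (idm m ⊗ₘ Y) = (idm n ⊗ₘ Y) ⊚ (X ⊗ₘ idm m') := by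
  rw [tens_idm_comp_idm_tens, idm_tens_comp_tens_idm]

/-- Bookkeeping lemma `tens_eq_comp_left` of the binor tensor model of Temperley–Lieb recoupling theory (conventions of KL94 §8.2, §9). [folklore] -/
theorem tens_eq_comp_left (X : Mor K m n) (Y : Mor K m' n') :
    X ⊗ₘ Y = (X ⊗ₘ idm n') ⊚ (idm m ⊗ₘ Y) := (tens_idm_comp_idm_tens X Y).symm

/-- Bookkeeping lemma `tens_eq_comp_right` of the binor tensor model of Temperley–Lieb recoupling theory (conventions of KL94 §8.2, §9). [folklore] -/
theorem tens_eq_comp_right (X : Mor K m n) (Y : Mor K m' n') :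
    X ⊗ₘ Y = (idm n ⊗ₘ Y) ⊚ (X ⊗ₘ idm m') := (idm_tens_comp_tens_idm X Y).symm

/-- Bookkeeping lemma `tens_idm_one_idm_one` of the binor tensor model of Temperley–Lieb recoupling theory (conventions of KL94 §8.2, §9). [folklore] -/
theorem tens_idm_one_idm_one (X : Mor K m n) : X ⊗ₘ idm 1 ⊗ₘ idm 1 = X ⊗ₘ idm 2 := by
  apply ext'
  simp only [tens_val, idm_val]
  rw [← tensR_assoc, tensR_idR_idR]

/-- Bookkeeping lemma `comp_assoc_of` of the binor tensor model of Temperley–Lieb recoupling theory (conventions of KL94 §8.2, §9). [folklore] -/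
theorem comp_assoc_of {X : Mor K n p} {Y : Mor K m n} {E : Mor K m p} (h : X ⊚ Y = E)
    (Z : Mor K m' m) : X ⊚ (Y ⊚ Z) = E ⊚ Z := by rw [comp_assoc, h]

/-! ### The hook `U = ∪∘∩`, Chebyshev numbers, partial trace, Jones–Wenzl projectors -/

/-- The Temperley–Lieb generator `U = ∪ ∘ ∩ : 2 → 2`. [cite: KauffmanLins1994, §2.2, §9.2] -/
def U (A : K) : Mor K 2 2 := cup A ⊚ cap A

/-- The Chebyshev numbers `Δ_n`: `Δ_0 = 1, Δ_1 = d, Δ_{n+2} = d Δ_{n+1} - Δ_n`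
(`Δ_n` = the loop value of the closed `n`-th projector). [cite: KauffmanLins1994, §9.3] -/
def Delta (A : K) : ℕ → K
  | 0 => 1
  | 1 => dval A
  | n + 2 => dval A * Delta A (n + 1) - Delta A n

/-- Bookkeeping lemma `Delta_zero` of the binor tensor model of Temperley–Lieb recoupling theory (conventions of KL94 §8.2, §9). [folklore] -/
@[simp] theorem Delta_zero (A : K) : Delta A 0 = 1 := rfl
/-- Bookkeeping lemma `Delta_one` of the binor tensor model of Temperley–Lieb recoupling theory (conventions of KL94 §8.2, §9). [folklore] -/
@[simp] theorem Delta_one (A : K) : Delta A 1 = dval A := rfl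
/-- Bookkeeping lemma `Delta_succ_succ` of the binor tensor model of Temperley–Lieb recoupling theory (conventions of KL94 §8.2, §9). [folklore] -/
theorem Delta_succ_succ (A : K) (n : ℕ) :
    Delta A (n + 2) = dval A * Delta A (n + 1) - Delta A n := rfl

/-- Right partial trace: closing off the last strand. [cite: KauffmanLins1994, §9.8] -/
def rptr (A : K) (X : Mor K (m + 1) (n + 1)) : Mor K m n :=
  (idm n ⊗ₘ cap A :) ⊚ (X ⊗ₘ idm 1 :) ⊚ (idm m ⊗ₘ cup A :)

/-- The Jones–Wenzl projectors `f_n ∈ TL_n` by the recursion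
`f_{n+2} = f_{n+1} ⊗ 𝟙 - (Δ_n/Δ_{n+1}) (f_{n+1} ⊗ 𝟙) U_{n+1} (f_{n+1} ⊗ 𝟙)`.
[cite: KauffmanLins1994, §3.1 Def. 1, §9.6] -/
def jw (A : K) : (n : ℕ) → Mor K n n
  | 0 => idm 0
  | 1 => idm 1
  | n + 2 =>
    (jw A (n + 1) ⊗ₘ idm 1 :) -
      (Delta A n / Delta A (n + 1)) •
        ((jw A (n + 1) ⊗ₘ idm 1 :) ⊚ (idm n ⊗ₘ U A :) ⊚ (jw A (n + 1) ⊗ₘ idm 1 :))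

/-- Bookkeeping lemma `jw_zero` of the binor tensor model of Temperley–Lieb recoupling theory (conventions of KL94 §8.2, §9). [folklore] -/
theorem jw_zero (A : K) : jw A 0 = (idm 0 : Mor K 0 0) := by rw [jw]
/-- Bookkeeping lemma `jw_one` of the binor tensor model of Temperley–Lieb recoupling theory (conventions of KL94 §8.2, §9). [folklore] -/
theorem jw_one (A : K) : jw A 1 = (idm 1 : Mor K 1 1) := by rw [jw]
/-- Bookkeeping lemma `jw_succ_succ` of the binor tensor model of Temperley–Lieb recoupling theory (conventions of KL94 §8.2, §9). [folklore] -/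
theorem jw_succ_succ (A : K) (n : ℕ) : jw A (n + 2) = (jw A (n + 1) ⊗ₘ idm 1 :) -
    (Delta A n / Delta A (n + 1)) •
      ((jw A (n + 1) ⊗ₘ idm 1 :) ⊚ (idm n ⊗ₘ U A :) ⊚ (jw A (n + 1) ⊗ₘ idm 1 :)) := by
  rw [jw]

variable (A : K)

/-! #### Partial trace lemmas -/

/-- Bookkeeping lemma `rptr_def` of the binor tensor model of Temperley–Lieb recoupling theory (conventions of KL94 §8.2, §9). [folklore] -/
theorem rptr_def (X : Mor K (m + 1) (n + 1)) :
    rptr A X = (idm n ⊗ₘ cap A :) ⊚ (X ⊗ₘ idm 1 :) ⊚ (idm m ⊗ₘ cup A :) := rfl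

/-- Bookkeeping lemma `rptr_add` of the binor tensor model of Temperley–Lieb recoupling theory (conventions of KL94 §8.2, §9). [folklore] -/
theorem rptr_add (X Y : Mor K (m + 1) (n + 1)) : rptr A (X + Y) = rptr A X + rptr A Y := by
  simp only [rptr_def, add_tens, comp_add, add_comp]

/-- Bookkeeping lemma `rptr_sub` of the binor tensor model of Temperley–Lieb recoupling theory (conventions of KL94 §8.2, §9). [folklore] -/
theorem rptr_sub (X Y : Mor K (m + 1) (n + 1)) : rptr A (X - Y) = rptr A X - rptr A Y := by
  simp only [rptr_def, sub_tens, comp_sub, sub_comp]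

/-- Bookkeeping lemma `rptr_smul` of the binor tensor model of Temperley–Lieb recoupling theory (conventions of KL94 §8.2, §9). [folklore] -/
theorem rptr_smul (c : K) (X : Mor K (m + 1) (n + 1)) : rptr A (c • X) = c • rptr A X := by
  simp only [rptr_def, smul_tens, comp_smul, smul_comp]

/-- Bookkeeping lemma `rptr_zero` of the binor tensor model of Temperley–Lieb recoupling theory (conventions of KL94 §8.2, §9). [folklore] -/
@[simp] theorem rptr_zero : rptr A (0 : Mor K (m + 1) (n + 1)) = 0 := by
  rw [rptr_def, zero_tens, comp_zero, zero_comp]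

/-- `Δ_0, …, Δ_{N-1} ≠ 0`: the range in which `f_N` is a genuine projector. [cite: KauffmanLins1994, §9.3] -/
def Good (A : K) (N : ℕ) : Prop := ∀ m < N, Delta A m ≠ 0

/-- Bookkeeping lemma `mono` of the binor tensor model of Temperley–Lieb recoupling theory (conventions of KL94 §8.2, §9). [folklore] -/
theorem Good.mono {A : K} {N N' : ℕ} (h : Good A N) (hN : N' ≤ N) : Good A N' :=
  fun m hm => h m (lt_of_lt_of_le hm hN)

/-- Bookkeeping lemma `ne` of the binor tensor model of Temperley–Lieb recoupling theory (conventions of KL94 §8.2, §9). [folklore] -/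
theorem Good.ne {A : K} {N : ℕ} (h : Good A N) {m : ℕ} (hm : m < N) : Delta A m ≠ 0 := h m hm

variable {A}

/-- The full (right) trace: close off all strands. [cite: KauffmanLins1994, §2.2 (trace)] -/
def trAll (A : K) : {n : ℕ} → Mor K n n → K
  | 0, X => X.val (fun _ => false) (fun _ => false)
  | _ + 1, X => trAll A (rptr A X)

/-- Bookkeeping lemma `trAll_zero` of the binor tensor model of Temperley–Lieb recoupling theory (conventions of KL94 §8.2, §9). [folklore] -/
theorem trAll_zero (X : Mor K 0 0) : trAll A X = X.val (fun _ => false) (fun _ => false) := rfl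
/-- Bookkeeping lemma `trAll_succ` of the binor tensor model of Temperley–Lieb recoupling theory (conventions of KL94 §8.2, §9). [folklore] -/
theorem trAll_succ (X : Mor K (n + 1) (n + 1)) : trAll A X = trAll A (rptr A X) := rfl

/-- Bookkeeping lemma `trAll_add` of the binor tensor model of Temperley–Lieb recoupling theory (conventions of KL94 §8.2, §9). [folklore] -/
theorem trAll_add : ∀ {n : ℕ} (X Y : Mor K n n), trAll A (X + Y) = trAll A X + trAll A Y
  | 0, _, _ => rfl
  | n + 1, X, Y => by rw [trAll_succ, rptr_add, trAll_add]; rfl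

/-- Bookkeeping lemma `trAll_smul` of the binor tensor model of Temperley–Lieb recoupling theory (conventions of KL94 §8.2, §9). [folklore] -/
theorem trAll_smul : ∀ {n : ℕ} (c : K) (X : Mor K n n), trAll A (c • X) = c * trAll A X
  | 0, _, _ => rfl
  | n + 1, c, X => by rw [trAll_succ, rptr_smul, trAll_smul]; rfl

/-- Bookkeeping lemma `trAll_neg` of the binor tensor model of Temperley–Lieb recoupling theory (conventions of KL94 §8.2, §9). [folklore] -/
theorem trAll_neg (X : Mor K n n) : trAll A (-X) = -trAll A X := by
  rw [← neg_one_smul K X, trAll_smul]; ring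

/-- Bookkeeping lemma `trAll_sub` of the binor tensor model of Temperley–Lieb recoupling theory (conventions of KL94 §8.2, §9). [folklore] -/
theorem trAll_sub (X Y : Mor K n n) : trAll A (X - Y) = trAll A X - trAll A Y := by
  rw [sub_eq_add_neg, trAll_add, trAll_neg]; ring

/-- Bookkeeping lemma `trAll_zero_mor` of the binor tensor model of Temperley–Lieb recoupling theory (conventions of KL94 §8.2, §9). [folklore] -/
@[simp] theorem trAll_zero_mor : ∀ {n : ℕ}, trAll A (0 : Mor K n n) = 0
  | 0 => rfl
  | n + 1 => by
    rw [trAll_succ, rptr_zero, trAll_zero_mor]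

/-- Bookkeeping lemma `trAll_idm_zero` of the binor tensor model of Temperley–Lieb recoupling theory (conventions of KL94 §8.2, §9). [folklore] -/
theorem trAll_idm_zero : trAll A (idm 0 : Mor K 0 0) = 1 := by
  rw [trAll_zero, idm_val, idR_zero]

end Mor

/-- `𝟙_i ⊗ X ⊗ 𝟙_j` at the raw level, `X` having `a` output and `b` input strands. [folklore] -/
def block (i : ℕ) (X : Raw K) (a b j : ℕ) : Raw K := tensR (i + a) (i + b) (tensR i i (idR i) X) (idR j)

namespace Mor

variable (A : K)

/-- The cup inserted after the first `i` of `n` strands: `𝟙_i ⊗ ∪ ⊗ 𝟙_{n-i} : n → n + 2`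
(`0` if `i > n`). [folklore] -/
def cupAt (n i : ℕ) : Mor K n (n + 2) :=
  if h : i ≤ n then (idm i ⊗ₘ cup A ⊗ₘ idm (n - i) :).cast (by omega) (by omega) else 0

/-- The cap after the first `i` of `n` strands: `𝟙_i ⊗ ∩ ⊗ 𝟙_{n-i} : n + 2 → n`
(`0` if `i > n`). [folklore] -/
def capAt (n i : ℕ) : Mor K (n + 2) n :=
  if h : i ≤ n then (idm i ⊗ₘ cap A ⊗ₘ idm (n - i) :).cast (by omega) (by omega) else 0

/-- The hook `U_{i+1} = 𝟙_i ⊗ U ⊗ 𝟙_{n-i}` on `n + 2` strands. [cite: KauffmanLins1994, §2.2] -/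
def UAt (n i : ℕ) : Mor K (n + 2) (n + 2) := cupAt A n i ⊚ capAt A n i

end Mor

/-! ### The Temperley–Lieb subcategory -/

open Mor

/-- The Temperley–Lieb morphisms of the tensor model: generated from identities by composing with
elementary cups and caps on the left and taking linear combinations. [cite: KauffmanLins1994, §2.2] -/
inductive IsTL (A : K) : {m n : ℕ} → Mor K m n → Prop
  | idm (n : ℕ) : IsTL A (idm n)
  | cup_comp {m n : ℕ} (i : ℕ) (hi : i ≤ n) (X : Mor K m n) : IsTL A X → IsTL A (cupAt A n i ⊚ X)
  | cap_comp {m n : ℕ} (i : ℕ) (hi : i ≤ n) (X : Mor K m (n + 2)) : IsTL A X → IsTL A (capAt A n i ⊚ X)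
  | zero {m n : ℕ} : IsTL A (0 : Mor K m n)
  | add {m n : ℕ} (X Y : Mor K m n) : IsTL A X → IsTL A Y → IsTL A (X + Y)
  | smul {m n : ℕ} (c : K) (X : Mor K m n) : IsTL A X → IsTL A (c • X)

namespace Mor

/-- Bookkeeping lemma `cast_eq_self` of the binor tensor model of Temperley–Lieb recoupling theory (conventions of KL94 §8.2, §9). [folklore] -/
theorem cast_eq_self (X : Mor K m n) (hm : m = m) (hn : n = n) : X.cast hm hn = X := rfl

/-- Left composition with a fixed morphism, as a linear map. [folklore] -/
def compLeftL (Z : Mor K n p) : Mor K m n →ₗ[K] Mor K m p where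
  toFun Y := Z ⊚ Y
  map_add' := comp_add Z
  map_smul' := comp_smul Z

/-- Bookkeeping lemma `compLeftL_apply` of the binor tensor model of Temperley–Lieb recoupling theory (conventions of KL94 §8.2, §9). [folklore] -/
@[simp] theorem compLeftL_apply (Z : Mor K n p) (Y : Mor K m n) : compLeftL Z Y = Z ⊚ Y := rfl

end Mor

/-- Composites of elementary cups (ending with an identity). [folklore] -/
inductive IsCups (A : K) : {m n : ℕ} → Mor K m n → Prop
  | idm (n : ℕ) : IsCups A (idm n)
  | cup_comp {m n : ℕ} (i : ℕ) (hi : i ≤ n) (C : Mor K m n) : IsCups A C → IsCups A (cupAt A n i ⊚ C)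


/-- The span of `C ∘ f_m` over cup composites `C : m → n`. [folklore] -/
def cupSpan (A : K) (m n : ℕ) : Submodule K (Mor K m n) :=
  Submodule.span K {Y | ∃ C : Mor K m n, IsCups A C ∧ Y = C ⊚ jw A m}

/-- Number of `true` bits among the first `n`. [folklore] -/
def ct (n : ℕ) (s : Idx) : ℕ := ((Finset.range n).filter (fun i => s i = true)).card

/-- Weight preservation of a raw morphism `m → n`: `#(+) − #(−)` is the same on both sides of a
nonzero entry. [folklore] -/
def WtPres (m n : ℕ) (X : Raw K) : Prop := ∀ s t, X s t ≠ 0 → 2 * ct n s + m = 2 * ct m t + n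

/-- The bit weights `-A²` (for `+`) and `-A⁻²` (for `−`) of the quantum trace. [cite: KauffmanLins1994, §9.8] -/
def bw (A : K) : Bool → K
  | true => -A ^ 2
  | false => -A⁻¹ ^ 2

/-- Bookkeeping lemma `bw_true` of the binor tensor model of Temperley–Lieb recoupling theory (conventions of KL94 §8.2, §9). [folklore] -/
@[simp] theorem bw_true (A : K) : bw A true = -A ^ 2 := rfl
/-- Bookkeeping lemma `bw_false` of the binor tensor model of Temperley–Lieb recoupling theory (conventions of KL94 §8.2, §9). [folklore] -/
@[simp] theorem bw_false (A : K) : bw A false = -A⁻¹ ^ 2 := rfl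

/-- The weight of the first `n` bits. [folklore] -/
def wprod (A : K) (n : ℕ) (s : Idx) : K := ∏ i ∈ Finset.range n, bw A (s i)

/-- The trace as a weighted sum of diagonal entries. [cite: KauffmanLins1994, §9.8] -/
def trW (A : K) (n : ℕ) (X : Raw K) : K := ∑ s : Fin n → Bool, wprod A n (pad s) * X (pad s) (pad s)

/-- The all-`+` bit-string (highest weight vector). [folklore] -/
def allT : Idx := fun _ => true

/-- Bookkeeping lemma `allT_apply` of the binor tensor model of Temperley–Lieb recoupling theory (conventions of KL94 §8.2, §9). [folklore] -/
@[simp] theorem allT_apply (i : ℕ) : allT i = true := rfl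

namespace Mor

variable (A : K)

/-- Left partial trace: closing off the first strand. [cite: KauffmanLins1994, §9.8] -/
def lptr (X : Mor K (m + 1) (n + 1)) : Mor K m n :=
  ((cap A ⊗ₘ idm n :) ⊚ (idm 1 ⊗ₘ X :).cast (by omega) (by omega) ⊚ (cup A ⊗ₘ idm m :)).cast
    (Nat.zero_add m) (Nat.zero_add n)

end Mor

/-! ### Negligible morphisms -/

/-- The **negligible** Temperley–Lieb morphisms `m → n`: those pairing to zero with every
Temperley–Lieb morphism `n → m` under the trace ("equal to `0` as functionals", KL).
[cite: KauffmanLins1994, §7.1 (equality as functionals on dual tangles)] -/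
def Neg (A : K) (m n : ℕ) : Submodule K (Mor K m n) where
  carrier := {N | IsTL A N ∧ ∀ Y : Mor K n m, IsTL A Y → trAll A (Y ⊚ N) = 0}
  add_mem' := by
    rintro N N' ⟨hN, hN0⟩ ⟨hN', hN'0⟩
    exact ⟨hN.add _ _ hN', fun Y hY => by rw [comp_add, trAll_add, hN0 Y hY, hN'0 Y hY, add_zero]⟩
  zero_mem' := ⟨IsTL.zero, fun Y _ => by rw [comp_zero, trAll_zero_mor]⟩
  smul_mem' := by
    rintro c N ⟨hN, hN0⟩
    exact ⟨hN.smul _ _, fun Y hY => by rw [comp_smul, trAll_smul, hN0 Y hY, mul_zero]⟩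

namespace Mor

variable (A : K)

/-- The standard nested straddling cups of a 3-vertex: `z` cups connecting the last strands of
the left block (`x + z` strands) with the first strands of the right block (`y + z` strands), the
remaining `x` and `y` strands passing through. [cite: KauffmanLins1994, §4.1 Def. 3, §9.9] -/
def stdCups (x y : ℕ) : (z : ℕ) → Mor K (x + y) ((x + z) + (y + z))
  | 0 => idm (x + y)
  | z + 1 => (cupAt A ((x + z) + (y + z)) (x + z) ⊚ stdCups x y z).cast rfl (by omega)

/-- The **3-vertex** with legs `a = x + z`, `b = y + z` (top) and `c = x + y` (bottom):
`(f_a ⊗ f_b) ∘ (nested cups) ∘ f_c`; `x = (a+c-b)/2`, `y = (b+c-a)/2`, `z = (a+b-c)/2` internal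
lines. [cite: KauffmanLins1994, §4.1 Def. 3, §9.9] -/
def vert (x z y : ℕ) : Mor K (x + y) ((x + z) + (y + z)) :=
  (jw A (x + z) ⊗ₘ jw A (y + z)) ⊚ stdCups A x y z ⊚ jw A (x + y)

/-- Bookkeeping lemma `stdCups_zero` of the binor tensor model of Temperley–Lieb recoupling theory (conventions of KL94 §8.2, §9). [folklore] -/
theorem stdCups_zero (x y : ℕ) : stdCups A x y 0 = idm (x + y) := rfl
/-- Bookkeeping lemma `stdCups_succ` of the binor tensor model of Temperley–Lieb recoupling theory (conventions of KL94 §8.2, §9). [folklore] -/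
theorem stdCups_succ (x y z : ℕ) :
    stdCups A x y (z + 1) = (cupAt A ((x + z) + (y + z)) (x + z) ⊚ stdCups A x y z).cast rfl (by omega) := rfl
/-- Bookkeeping lemma `vert_def` of the binor tensor model of Temperley–Lieb recoupling theory (conventions of KL94 §8.2, §9). [folklore] -/
theorem vert_def (x z y : ℕ) :
    vert A x z y = (jw A (x + z) ⊗ₘ jw A (y + z)) ⊚ stdCups A x y z ⊚ jw A (x + y) := rfl

end Mor

/-- The line spanned by the 3-vertex `c → a ⊗ b` (zero if `(a, b, c)` is not admissible).
[cite: KauffmanLins1994, §9.9] -/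
def vertSpan (A : K) (a b c : ℕ) : Submodule K (Mor K c (a + b)) :=
  Submodule.span K {V | ∃ (x y z : ℕ) (hc : x + y = c) (hab : (x + z) + (y + z) = a + b),
    a = x + z ∧ V = (vert A x z y).cast hc hab}

namespace Mor

variable (A : K)

/-- The standard nested straddling caps (mirror image of `stdCups`). [cite: KauffmanLins1994, §4.1, §9.9] -/
def stdCaps (x y : ℕ) : (z : ℕ) → Mor K ((x + z) + (y + z)) (x + y)
  | 0 => idm (x + y)
  | z + 1 => (stdCaps x y z ⊚ capAt A ((x + z) + (y + z)) (x + z)).cast (by omega) rfl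

/-- The **dual 3-vertex** `a ⊗ b → c`: `f_c ∘ (nested caps) ∘ (f_a ⊗ f_b)`. [cite: KauffmanLins1994, §4.1, §9.9] -/
def dvert (x z y : ℕ) : Mor K ((x + z) + (y + z)) (x + y) :=
  jw A (x + y) ⊚ stdCaps A x y z ⊚ (jw A (x + z) ⊗ₘ jw A (y + z))

/-- Bookkeeping lemma `stdCaps_zero` of the binor tensor model of Temperley–Lieb recoupling theory (conventions of KL94 §8.2, §9). [folklore] -/
theorem stdCaps_zero (x y : ℕ) : stdCaps A x y 0 = idm (x + y) := rfl
/-- Bookkeeping lemma `stdCaps_succ` of the binor tensor model of Temperley–Lieb recoupling theory (conventions of KL94 §8.2, §9). [folklore] -/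
theorem stdCaps_succ (x y z : ℕ) :
    stdCaps A x y (z + 1) = (stdCaps A x y z ⊚ capAt A ((x + z) + (y + z)) (x + z)).cast (by omega) rfl := rfl
/-- Bookkeeping lemma `dvert_def` of the binor tensor model of Temperley–Lieb recoupling theory (conventions of KL94 §8.2, §9). [folklore] -/
theorem dvert_def (x z y : ℕ) :
    dvert A x z y = jw A (x + y) ⊚ stdCaps A x y z ⊚ (jw A (x + z) ⊗ₘ jw A (y + z)) := rfl

/-- The **θ-net** `θ(a, b, c)`, `a = x + z`, `b = y + z`, `c = x + y`: the trace of
(dual vertex) ∘ (vertex). [cite: KauffmanLins1994, §6, §9.10] -/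
def theta (x z y : ℕ) : K := trAll A (dvert A x z y ⊚ vert A x z y)

/-- The core of the θ-net: caps ∘ (f_a ⊗ f_b) ∘ cups ∘ f_c. [folklore] -/
def thetaCore (x z y : ℕ) : Mor K (x + y) (x + y) :=
  stdCaps A x y z ⊚ (jw A (x + z) ⊗ₘ jw A (y + z)) ⊚ stdCups A x y z ⊚ jw A (x + y)

variable {A} in
/-- Bookkeeping lemma `cast_smul` of the binor tensor model of Temperley–Lieb recoupling theory (conventions of KL94 §8.2, §9). [folklore] -/
theorem cast_smul (c : K) (X : Mor K m n) (hm : m = m') (hn : n = n') :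
    (c • X).cast hm hn = c • X.cast hm hn := by subst hm hn; rfl

/-- The coefficient `λ(x', z) = (-1)^z Δ_{x'} / Δ_{x'+z}` (`= [x'+1]/[x'+z+1]`). [folklore] -/
def lam (A : K) (x' z : ℕ) : K := (-1) ^ z * (Delta A x' / Delta A (x' + z))

/-- The bent vertex `W(x', z, y) : c → a ⊗ b` (`a = x'+1+z`, `b = y+z`, `c = x'+1+y`): the vertex cups
under `f_a ⊗ 𝟙_b`, with the last strand of `f_a` fed into `f_{b+1}`. [folklore] -/
def bentW (x' y z : ℕ) : Mor K (x' + 1 + y) ((x' + 1 + z) + (y + z)) :=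
  ((idm (x' + z) ⊗ₘ jw A (y + z + 1) :).cast (show x' + z + (y + z + 1) = x' + 1 + z + (y + z) by omega)
    (show x' + z + (y + z + 1) = x' + 1 + z + (y + z) by omega)) ⊚ (jw A (x' + 1 + z) ⊗ₘ idm (y + z) :) ⊚
      stdCups A (x' + 1) y z ⊚ jw A (x' + 1 + y)

/-- The dual bent vertex `a ⊗ b → c`. [folklore] -/
def bentWd (x' y z : ℕ) : Mor K ((x' + 1 + z) + (y + z)) (x' + 1 + y) :=
  stdCaps A (x' + 1) y z ⊚ (jw A (x' + 1 + z) ⊗ₘ idm (y + z) :) ⊚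
    ((idm (x' + z) ⊗ₘ jw A (y + z + 1) :).cast (show x' + z + (y + z + 1) = x' + 1 + z + (y + z) by omega)
      (show x' + z + (y + z + 1) = x' + 1 + z + (y + z) by omega))

end Mor

/-! ### Quantum integers and factorials; the θ-net formula -/

/-- The quantum integers `[n]` (`[0] = 0`, `[1] = 1`, `[n+2] = (A² + A⁻²)[n+1] - [n]`; `[n] = (A^{2n}-A^{-2n})/(A²-A⁻²)`).
[cite: KauffmanLins1994, §9.3; MasbaumVogel1994, §1] -/
def qint (A : K) : ℕ → K
  | 0 => 0
  | 1 => 1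
  | n + 2 => (A ^ 2 + A⁻¹ ^ 2) * qint A (n + 1) - qint A n

/-- Bookkeeping lemma `qint_zero` of the binor tensor model of Temperley–Lieb recoupling theory (conventions of KL94 §8.2, §9). [folklore] -/
@[simp] theorem qint_zero (A : K) : qint A 0 = 0 := rfl
/-- Bookkeeping lemma `qint_one` of the binor tensor model of Temperley–Lieb recoupling theory (conventions of KL94 §8.2, §9). [folklore] -/
@[simp] theorem qint_one (A : K) : qint A 1 = 1 := rfl
/-- Bookkeeping lemma `qint_succ_succ` of the binor tensor model of Temperley–Lieb recoupling theory (conventions of KL94 §8.2, §9). [folklore] -/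
theorem qint_succ_succ (A : K) (n : ℕ) : qint A (n + 2) = (A ^ 2 + A⁻¹ ^ 2) * qint A (n + 1) - qint A n := rfl

/-- The quantum factorial `[n]! = [1][2]⋯[n]`. [cite: KauffmanLins1994, §9.10] -/
def qfact (A : K) : ℕ → K
  | 0 => 1
  | n + 1 => qfact A n * qint A (n + 1)

/-- Bookkeeping lemma `qfact_zero` of the binor tensor model of Temperley–Lieb recoupling theory (conventions of KL94 §8.2, §9). [folklore] -/
@[simp] theorem qfact_zero (A : K) : qfact A 0 = 1 := rfl
/-- Bookkeeping lemma `qfact_succ` of the binor tensor model of Temperley–Lieb recoupling theory (conventions of KL94 §8.2, §9). [folklore] -/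
theorem qfact_succ (A : K) (n : ℕ) : qfact A (n + 1) = qfact A n * qint A (n + 1) := rfl

namespace Mor

/-- Right composition with a fixed morphism, as a linear map. [folklore] -/
def compRightL (Z : Mor K m n) : Mor K n p →ₗ[K] Mor K m p where
  toFun Y := Y ⊚ Z
  map_add' X Y := add_comp X Y Z
  map_smul' c X := smul_comp c X Z

/-- Bookkeeping lemma `compRightL_apply` of the binor tensor model of Temperley–Lieb recoupling theory (conventions of KL94 §8.2, §9). [folklore] -/
@[simp] theorem compRightL_apply (Z : Mor K m n) (Y : Mor K n p) : compRightL Z Y = Y ⊚ Z := rfl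

/-- `- ⊗ 𝟙_k` as a linear map. [folklore] -/
def tensIdmL (m n k : ℕ) : Mor K m n →ₗ[K] Mor K (m + k) (n + k) where
  toFun Y := Y ⊗ₘ idm k
  map_add' X Y := add_tens X Y _
  map_smul' c X := smul_tens c X _

/-- Bookkeeping lemma `tensIdmL_apply` of the binor tensor model of Temperley–Lieb recoupling theory (conventions of KL94 §8.2, §9). [folklore] -/
@[simp] theorem tensIdmL_apply (m n k : ℕ) (Y : Mor K m n) : tensIdmL m n k Y = Y ⊗ₘ idm k := rfl

end Mor

/-- The span of the Temperley–Lieb morphisms `m → n` factoring through a projector `f_j` with `j < J`: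
`P f_j Q`. [cite: KauffmanLins1994, §7.1 (proof of Lemma 17: "1_n = f_n + R_n")] -/
def thruSpan (A : K) (J m n : ℕ) : Submodule K (Mor K m n) :=
  Submodule.span K {X | ∃ (j : ℕ) (P : Mor K j n) (Q : Mor K m j), j < J ∧ IsTL A P ∧ IsTL A Q ∧ X = P ⊚ jw A j ⊚ Q}

/-! ### Label-level vertices and trees -/

/-- Admissibility of a triple of labels (parity and triangle inequalities; no level bound).
[cite: KauffmanLins1994, §4.1 Def. 4] -/
def Tri (a b c : ℕ) : Prop := (a + b + c) % 2 = 0 ∧ c ≤ a + b ∧ a ≤ b + c ∧ b ≤ c + a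

/-- Decidability instance (by unfolding the definition). [folklore] -/
instance (a b c : ℕ) : Decidable (Tri a b c) := by unfold Tri; infer_instance

/-- Bookkeeping lemma `tri_mk` of the binor tensor model of Temperley–Lieb recoupling theory (conventions of KL94 §8.2, §9). [folklore] -/
theorem tri_mk (x z y : ℕ) : Tri (x + z) (y + z) (x + y) := by unfold Tri; omega

/-- Bookkeeping lemma `decompose` of the binor tensor model of Temperley–Lieb recoupling theory (conventions of KL94 §8.2, §9). [folklore] -/
theorem Tri.decompose {a b c : ℕ} (h : Tri a b c) : ∃ x z y : ℕ, a = x + z ∧ b = y + z ∧ c = x + y := by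
  unfold Tri at h
  exact ⟨(a + c - b) / 2, (a + b - c) / 2, (b + c - a) / 2, by omega, by omega, by omega⟩

/-- Bookkeeping lemma `src` of the binor tensor model of Temperley–Lieb recoupling theory (conventions of KL94 §8.2, §9). [folklore] -/
theorem Tri.src {a b c : ℕ} (h : Tri a b c) : (a + c - b) / 2 + (b + c - a) / 2 = c := by unfold Tri at h; omega
/-- Bookkeeping lemma `tgt` of the binor tensor model of Temperley–Lieb recoupling theory (conventions of KL94 §8.2, §9). [folklore] -/
theorem Tri.tgt {a b c : ℕ} (h : Tri a b c) :
    (a + c - b) / 2 + (a + b - c) / 2 + ((b + c - a) / 2 + (a + b - c) / 2) = a + b := by unfold Tri at h; omega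

namespace Mor

variable (A : K)

/-- The 3-vertex `c → a ⊗ b` by labels (zero if the triple is not admissible). [cite: KauffmanLins1994, §4.1, §9.9] -/
def V (a b c : ℕ) : Mor K c (a + b) :=
  if h : Tri a b c then (vert A ((a + c - b) / 2) ((a + b - c) / 2) ((b + c - a) / 2)).cast h.src h.tgt else 0

/-- The dual 3-vertex `a ⊗ b → c` by labels. [cite: KauffmanLins1994, §4.1, §9.9] -/
def Vd (a b c : ℕ) : Mor K (a + b) c :=
  if h : Tri a b c then (dvert A ((a + c - b) / 2) ((a + b - c) / 2) ((b + c - a) / 2)).cast h.tgt h.src else 0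

/-- `θ(a,b,c)` by labels (`0` if not admissible). [cite: KauffmanLins1994, §9.10] -/
def thetaL (a b c : ℕ) : K := trAll A (Vd A a b c ⊚ V A a b c)

/-- The left tree `((a b)_f c)_e : e → a ⊗ b ⊗ c`. [cite: KauffmanLins1994, §9.14] -/
def treeL (a b c e f : ℕ) : Mor K e (a + b + c) := (V A a b f ⊗ₘ idm c :) ⊚ V A f c e

/-- The right tree `(a (b c)_g)_e : e → a ⊗ b ⊗ c`. [cite: KauffmanLins1994, §9.14] -/
def treeR (a b c e g : ℕ) : Mor K e (a + b + c) :=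
  (idm a ⊗ₘ V A b c g :).cast rfl (Nat.add_assoc a b c).symm ⊚ V A a g e

/-- The dual right tree `a ⊗ b ⊗ c → e`. [folklore] -/
def treeRd (a b c e g : ℕ) : Mor K (a + b + c) e :=
  Vd A a g e ⊚ (idm a ⊗ₘ Vd A b c g :).cast (Nat.add_assoc a b c).symm rfl

/-- The tetrahedral trace `Tet`: close the left tree with the dual right tree. [cite: KauffmanLins1994, §9.11–9.12] -/
def Tnet (a b c e f g : ℕ) : K := trAll A (treeRd A a b c e g ⊚ treeL A a b c e f)

/-- The recoupling coefficient `F^{abc}_{e;fg} = Tet · Δ_g / (θ(a,g,e) θ(b,c,g))`. [cite: KauffmanLins1994, §7.3 Prop. 11, §9.12] -/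
def Fco (a b c e f g : ℕ) : K := Tnet A a b c e f g * Delta A g / (thetaL A a g e * thetaL A b c g)

variable {A} in
/-- Bookkeeping lemma `cast_add` of the binor tensor model of Temperley–Lieb recoupling theory (conventions of KL94 §8.2, §9). [folklore] -/
theorem cast_add (X Y : Mor K m n) (hm : m = m') (hn : n = n') : (X + Y).cast hm hn = X.cast hm hn + Y.cast hm hn := by
  subst hm hn; rfl

/-- The linear map `X ↦ (f_a ⊗ (f_b ⊗ f_c) X) ∘ L` used to expand the left tree. [folklore] -/
def PhiL (a b c e f : ℕ) : Mor K (b + c) (b + c) →ₗ[K] Mor K e (a + b + c) where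
  toFun X := ((jw A a ⊗ₘ ((jw A b ⊗ₘ jw A c) ⊚ X)) :).cast (Nat.add_assoc a b c).symm (Nat.add_assoc a b c).symm ⊚
    treeL A a b c e f
  map_add' X Y := by rw [comp_add, tens_add, cast_add, add_comp]
  map_smul' r X := by rw [comp_smul, tens_smul, cast_smul, smul_comp]; rfl

/-- The linear map `c ↦ Σ_g c_g R_g` onto the span of the right trees. [folklore] -/
def Rmap (a b c e J : ℕ) : (Fin J → K) →ₗ[K] Mor K e (a + b + c) where
  toFun w := ∑ i : Fin J, w i • treeR A a b c e i
  map_add' w w' := by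
    rw [← Finset.sum_add_distrib]
    exact Finset.sum_congr rfl (fun i _ => by rw [Pi.add_apply, add_smul])
  map_smul' r w := by
    rw [Finset.smul_sum]
    exact Finset.sum_congr rfl (fun i _ => by rw [Pi.smul_apply, smul_eq_mul, smul_smul, RingHom.id_apply])

/-- `(((ab)_f c)_g d)_e`. [folklore] -/
def T1 (a b c d e f g : ℕ) : Mor K e (a + b + c + d) := (treeL A a b c g f ⊗ₘ idm d :) ⊚ V A g d e
/-- `((a(bc)_h)_g d)_e`. [folklore] -/
def T2 (a b c d e h g : ℕ) : Mor K e (a + b + c + d) := (treeR A a b c g h ⊗ₘ idm d :) ⊚ V A g d e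
/-- `(a((bc)_h d)_k)_e`. [folklore] -/
def T3 (a b c d e h k : ℕ) : Mor K e (a + b + c + d) :=
  (idm a ⊗ₘ treeL A b c d k h :).cast rfl (by omega) ⊚ V A a k e
/-- `(a(b(cd)_l)_k)_e`. [folklore] -/
def T4 (a b c d e l k : ℕ) : Mor K e (a + b + c + d) :=
  (idm a ⊗ₘ treeR A b c d k l :).cast rfl (by omega) ⊚ V A a k e
/-- The dual of `T4`. [folklore] -/
def T4d (a b c d e l k : ℕ) : Mor K (a + b + c + d) e :=
  Vd A a k e ⊚ (idm a ⊗ₘ treeRd A b c d k l :).cast (by omega) rfl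
/-- `((ab)_f (cd)_l)_e`. [folklore] -/
def T5 (a b c d e f l : ℕ) : Mor K e (a + b + c + d) :=
  (idm (a + b) ⊗ₘ V A c d l :).cast rfl (by omega) ⊚ treeL A a b l e f

/-- Embeddings of the three-leaf moves into four leaves. [folklore] -/
def E1 (a b c d f : ℕ) : Mor K (f + c + d) (a + b + c + d) := (V A a b f ⊗ₘ idm c ⊗ₘ idm d :)
/-- Bookkeeping definition `E2` of the binor tensor model of Temperley–Lieb recoupling theory (conventions of KL94 §8.2, §9). [folklore] -/
def E2 (a b c d h : ℕ) : Mor K (a + h + d) (a + b + c + d) :=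
  ((idm a ⊗ₘ V A b c h :).cast rfl (Nat.add_assoc a b c).symm ⊗ₘ idm d :)
/-- Bookkeeping definition `E5` of the binor tensor model of Temperley–Lieb recoupling theory (conventions of KL94 §8.2, §9). [folklore] -/
def E5 (a b c d l : ℕ) : Mor K (a + b + l) (a + b + c + d) := (idm (a + b) ⊗ₘ V A c d l :).cast rfl (by omega)

/-- `X ↦ (𝟙_a ⊗ X) ∘ V(a,k;e)`, the embedding of the innermost move. [folklore] -/
def E3L (a b c d e k : ℕ) : Mor K k (b + c + d) →ₗ[K] Mor K e (a + b + c + d) where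
  toFun X := (idm a ⊗ₘ X :).cast rfl (by omega) ⊚ V A a k e
  map_add' X Y := by rw [tens_add, cast_add, add_comp]
  map_smul' r X := by rw [tens_smul, cast_smul, smul_comp]; rfl

end Mor

/-! ### Quantum integers indexed by `ℤ`, inverse quantum factorials -/

section QZ

variable (A : K)

/-- `[n]` for `n ∈ ℤ`, via the closed form `(B^n - B^{-n})/(B - B⁻¹)`, `B = A²`. [folklore] -/
noncomputable def qintZ (n : ℤ) : K := ((A ^ 2) ^ n - (A ^ 2) ^ (-n)) / (A ^ 2 - (A ^ 2)⁻¹)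

/-- `[n]!` for `n ∈ ℤ` (junk `= [0]! = 1` on negatives). [folklore] -/
def qfactZ (n : ℤ) : K := qfact A n.toNat

/-- `1/[n]!` for `n ∈ ℤ`, `= 0` on negatives. [folklore] -/
noncomputable def qfinv (n : ℤ) : K := if n < 0 then 0 else (qfact A n.toNat)⁻¹


end QZ

/-! ### The alternating (Racah) summand and its three-term recursion -/

section Racah

variable (A : K)

/-- The summand `t(s) = (-1)^s [s+1]! / (Πᵢ [s-aᵢ]! Πⱼ [bⱼ-s]!)` of the tetrahedron sum, for integer
parameters, with `1/[negative]! = 0`. [cite: KauffmanLins1994, §9.11] -/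
noncomputable def tZ (a1 a2 a3 a4 b1 b2 b3 s : ℤ) : K :=
  (-1 : K) ^ s * qfactZ A (s + 1) * (qfinv A (s - a1) * qfinv A (s - a2) * qfinv A (s - a3) * qfinv A (s - a4)) *
    (qfinv A (b1 - s) * qfinv A (b2 - s) * qfinv A (b3 - s))

/-- The Racah sum `S(a;b) = Σ_{0 ≤ s ≤ N} t(s)` (all nonzero terms have `max aᵢ ≤ s ≤ min bⱼ`). [folklore] -/
noncomputable def SZ (a1 a2 a3 a4 b1 b2 b3 : ℤ) (N : ℕ) : K :=
  ∑ s ∈ Finset.range (N + 1), tZ A a1 a2 a3 a4 b1 b2 b3 (s : ℤ)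


end Racah

/-! ### The closed forms of the `6j`-symbol -/

section SixjP

variable (A : K)

/-- The **reduced closed form** of the Kauffman–Lins `6j`-symbol `{a b k; l e f} = F^{abl}_{e;fk}` in terms of
the integer Racah parameters `a₁ = (a+e+k)/2, a₂ = (b+l+k)/2, a₃ = (a+b+f)/2, a₄ = (l+e+f)/2`
(`b₁ = a₁+a₃-a, b₂ = a₁+a₄-e, b₃ = a₁+a₂-k`):
`(-1)^{k+a₁+a₂} [k+1]! [a₃-a]![a₃-b]![a₃-f]! [a₄-e]![a₄-l]![a₄-f]! S(a;b) / ([f]! [a₁+1]! [a₂+1]!)`.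
This is `Tet[a b k; l e f]·Δ_k/(θ(a,e,k) θ(b,l,k))` of [cite: KauffmanLins1994, §9.11–§9.12] with the common
factorials cancelled. -/
noncomputable def sixjP (a b l e f k a1 a2 a3 a4 : ℤ) : K :=
  (-1 : K) ^ (k + a1 + a2) * qfactZ A (k + 1) *
    (qfactZ A (a3 - a) * qfactZ A (a3 - b) * qfactZ A (a3 - f)) *
    (qfactZ A (a4 - e) * qfactZ A (a4 - l) * qfactZ A (a4 - f)) *
    SZ A a1 a2 a3 a4 (a1 + a3 - a) (a1 + a4 - e) (a1 + a2 - k) (a1 + a3 - a).toNat /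
    (qfactZ A f * qfactZ A (a1 + 1) * qfactZ A (a2 + 1))

/-- The closed form `{a b k; l e f}_A = F^{abl}_{e;fk}` by labels (`0` off the admissible tetrahedra).
[cite: KauffmanLins1994, §9.11–§9.12] -/
noncomputable def sixjR (a b l e f k : ℕ) : K :=
  if Tri a b f ∧ Tri f l e ∧ Tri b l k ∧ Tri a k e then
    sixjP A a b l e f k ((a + e + k) / 2 : ℕ) ((b + l + k) / 2 : ℕ) ((a + b + f) / 2 : ℕ) ((l + e + f) / 2 : ℕ)
  else 0

end SixjP

/-- Kauffman–Lins' variable `A = e^{iπ/(2r)}`, `r = k + 2`, so that `q = A² = e^{iπ/r}` and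
`[n]_A = sin(nπ/r)/sin(π/r)`. [cite: KauffmanLins1994, §9.4] -/
noncomputable def klA (k : ℕ) : ℂ := Complex.exp (↑Real.pi * Complex.I / (2 * ((k : ℂ) + 2)))

end TemperleyLieb

end Literature.RepresentationTheory.ModularTensorCategories
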